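import Literature.NumberTheory.Transcendental.DiazMainIIISmallBound
import HarnessLib

/-!
# Laurent's Théorème 3 iii) — the family is small at `θ`, eventually

Topic `Literature/NumberTheory/Transcendental`. Sixth step of the conditional proof of the large
range of `Diaz1989_main_iii` (`DiazMain.lean`; M. Laurent, Astérisque 198–200 (1991), §3.1,
Théorème 3 iii); Diaz 1989 / Philippon 1986, Thm 2.12 (i)) from `Philippon1986_mainCriterion` and
`Philippon1986_GaGm`, after `DiazMainIIISmallBound.lean` (`small_of_bounds`: the smallness
`|Q_{l,t,j}(θ)| ≤ e^{-Ψ/2^{m+4}}` from three numerical inequalities `termA, termB, termC ≤ e^{-Ψ/2^{m+4}}/3`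
and six conditions on `ε_b = e^{-ρ}` at level `X`) and `DiazMainIIIParams.lean`: these numerical
hypotheses hold for all large `X` — the asymptotic bookkeeping of Diaz's §II-4-2 ("majoration de
`|Q_{μj}(θ)|`") in the multiplicity case (the bookkeeping is ours). Everything is PROVED.

* The atoms `Pw = X^{1+m/n}` (`≍ S`), `Om = X^{1+m/n+m}` (`≍ SM^m`, `Ψ = Ω log X`, `Φ = P log X`)
  and their relations (`atoms`); the good sizes at level `X` (`GoodSize`, `eventually_goodSize`,
  `sizes`).
* Logarithms of the factors at a good `X`, each `≤ KΦ`, `≤ -ρ + KΦ` or `≤ KΩ` with an explicit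
  constant: `log_Sfact_le`, `log_cardAM_le` (`KAM`), `log_Ccoef_le` (`KC`), `log_kapX_le` (`KK`),
  `log_epsJ_le` (`Keps`), `log_hermH_le` (the Hermite bound, `SM^m log(2(t+r̄)) ≤ l_cΩ + kΨ`),
  `log_Bgr_le`, `SN_log_qbar_le` (the geometric gain `SM^m log q̄ ≤ KΩ - Ψ/2^{m+2}`).
* `termA_le` (`termA ≤ 3e^{T_A(Φ+Ω) - Ψ/2^{m+2}}`), `termB_le` (`termB ≤ e^{-ρ + T_BΦ}`), `termC_le`
  (`termC ≤ e^{-ρ + T_CΦ}`), `eps_conditions` (the six conditions on `ε_b` once `K_E ≤ X`).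
* **`eventually_small3`** — for `n ≥ 1` frequencies `y`, `m = m'+1` points `x` with `x_m ≠ 0` and a
  linear measure of independence (which separates the points `l·x`), and the constant `c` of the
  zero lemma: for all large `X`, for Siegel's unknowns `p`, every `θ'` in the ball of radius
  `e^{-ρ}`, every minimal index `j` at `θ'`, every `l ≤ M₂`, `t < S`: `|Q_{l,t,j}(θ)| ≤ e^{-Ψ/2^{m+4}}`
  (since `ρ = 4Ψ` while `Φ, Ω = o(Ψ)`).

## References

* M. Laurent, *Sur quelques résultats récents de transcendance*, Astérisque 198–200 (1991),
  §3.1, Théorème 3 iii), p. 213. [Laurent1991]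
* G. Diaz, *Grands degrés de transcendance pour des familles d'exponentielles*, J. Number Theory
  31 (1989), 1–23, §II-4-2, p. 15 (the model, without multiplicities). [Diaz1989]
-/

noncomputable section

open MvPolynomial Finset Complex Filter Real
open Literature.NumberTheory.Transcendental.ExpGrid
open Literature.NumberTheory.Transcendental.Asymp
open Literature.NumberTheory.Transcendental.DiazThm1 (scale_zero_eq_exp scale_mono Separated)

namespace Literature.NumberTheory.Transcendental

namespace DiazMainIII

variable {n : ℕ}

/-! ### Elementary logarithmic bookkeeping -/

/-- `log (N !) ≤ N log N`. [folklore] -/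
theorem log_factorial_le (N : ℕ) : Real.log (N.factorial : ℝ) ≤ N * Real.log N := by
  rcases Nat.eq_zero_or_pos N with rfl | hN
  · simp
  have h := Nat.factorial_le_pow N
  calc Real.log (N.factorial : ℝ) ≤ Real.log ((N : ℝ) ^ N) :=
        Real.log_le_log (by exact_mod_cast Nat.factorial_pos N) (by exact_mod_cast h)
    _ = N * Real.log N := by rw [Real.log_pow]


/-! ### The atoms `P = X^{1+m/n}`, `Ω = X^{1+m/n+m}` and the good sizes at level `X` -/

/-- `P(X) = X^{1+m/n}` (`≍ S = LM`). [folklore] -/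
def Pw (n m : ℕ) (X : ℝ) : ℝ := scale (1 + (m : ℝ) / n) 0 X

/-- `Ω(X) = X^{1+m/n+m}` (`≍ SM^m`, `Ψ = Ω log X`). [folklore] -/
def Om (n m : ℕ) (X : ℝ) : ℝ := scale (1 + (m : ℝ) / n + m) 0 X

/-- **The atoms at `X ≥ e`.** [folklore] -/
theorem atoms {m : ℕ} (hn : 1 ≤ n) (hm : 1 ≤ m) {X : ℝ} (hX : Real.exp 1 ≤ X) :
    1 < X ∧ 1 ≤ Real.log X ∧ 1 ≤ Pw n m X ∧ X ≤ Pw n m X ∧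
      Pw n m X * X ^ m = Om n m X ∧ Om n m X * Real.log X = Psi3 n m X ∧
      Pw n m X * Real.log X = Phi3 n m X ∧ Pw n m X ≤ Phi3 n m X ∧ Pw n m X * X ≤ Om n m X ∧
      Pw n m X ≤ Om n m X ∧ Phi3 n m X ≤ Psi3 n m X ∧ Om n m X ≤ Psi3 n m X ∧
      scale ((m : ℝ) / n) 0 X * X = Pw n m X := by
  have hX1 : 1 < X := lt_of_lt_of_le (by have := Real.exp_one_gt_d9; linarith) hX
  have hX0 : 0 < X := by linarith
  have hlog : 1 ≤ Real.log X := by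
    rw [← Real.log_exp 1]; exact Real.log_le_log (Real.exp_pos 1) hX
  have hmn : (0 : ℝ) ≤ (m : ℝ) / n := by positivity
  have hm1 : (1 : ℝ) ≤ m := by exact_mod_cast hm
  have hP : Pw n m X = Real.exp ((1 + (m : ℝ) / n) * Real.log X) := by
    rw [Pw, scale_zero_eq_exp _ hX0]
  have hO : Om n m X = Real.exp ((1 + (m : ℝ) / n + m) * Real.log X) := by
    rw [Om, scale_zero_eq_exp _ hX0]
  have hXe : X = Real.exp (Real.log X) := (Real.exp_log hX0).symm
  have hXm : X ^ m = Real.exp (m * Real.log X) := by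
    rw [Real.exp_nat_mul, Real.exp_log hX0]
  have hl0 : 0 ≤ Real.log X := by linarith
  refine ⟨hX1, hlog, ?_, ?_, ?_, ?_, ?_, ?_, ?_, ?_, ?_, ?_, ?_⟩
  · rw [hP]; exact Real.one_le_exp (by positivity)
  · rw [hP]; conv_lhs => rw [hXe]
    exact Real.exp_le_exp.mpr (by nlinarith)
  · rw [hP, hO, hXm, ← Real.exp_add]; congr 1; ring
  · rw [Om, Psi3, scale, scale, Real.rpow_zero, Real.rpow_one, mul_one]
  · rw [Pw, Phi3, scale, scale, Real.rpow_zero, Real.rpow_one, mul_one]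
  · rw [Pw, Phi3, scale, scale, Real.rpow_zero, Real.rpow_one, mul_one]
    have h0 : 0 ≤ X ^ (1 + (m : ℝ) / n) := Real.rpow_nonneg hX0.le _
    nlinarith
  · rw [hP, hO]
    calc Real.exp ((1 + (m : ℝ) / n) * Real.log X) * X
        = Real.exp ((1 + (m : ℝ) / n) * Real.log X) * Real.exp (Real.log X) := by rw [Real.exp_log hX0]
      _ = Real.exp ((1 + (m : ℝ) / n) * Real.log X + Real.log X) := (Real.exp_add _ _).symm
      _ ≤ Real.exp ((1 + (m : ℝ) / n + m) * Real.log X) := Real.exp_le_exp.mpr (by nlinarith)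
  · rw [hP, hO]; exact Real.exp_le_exp.mpr (by nlinarith)
  · rw [Phi3, Psi3]
    exact scale_le_scale (by linarith) le_rfl hX
  · rw [Om, Psi3, scale, scale, Real.rpow_zero, Real.rpow_one, mul_one]
    have h0 : 0 ≤ X ^ (1 + (m : ℝ) / n + m) := Real.rpow_nonneg hX0.le _
    nlinarith
  · exact (scale_facts (m := m) hn hX1).1

/-- **Good sizes at level `X`**: `X ≥ e`, the sandwiches of `M` and `L`, and the height bound.
[folklore] -/
structure GoodSize (n m c : ℕ) (X : ℝ) : Prop where
  hX : Real.exp 1 ≤ X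
  Mlo : X / 2 ≤ Mq X
  M2 : 2 ≤ Mq X
  Llo : scale ((m : ℝ) / n) 0 X / 2 ≤ Lq n m X
  L2 : 2 ≤ Lq n m X
  H1 : 1 ≤ Hgt3 n m X
  logH : Real.log (Hgt3 n m X) ≤ KH n m * Phi3 n m X

/-- Good sizes hold eventually. [folklore] -/
theorem eventually_goodSize {m : ℕ} (hn : 1 ≤ n) (hm : 1 ≤ m) (c : ℕ) :
    ∀ᶠ X in atTop, GoodSize n m c X := by
  filter_upwards [eventually_ge_atTop (Real.exp 1), eventually_M_ge,
    eventually_L_ge (n := n) (m := m) hn hm, eventually_log_Hgt3_le (n := n) (m := m) hn hm]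
    with X hX hM hL hH
  exact ⟨hX, hM.1, hM.2, hL.1, hL.2, hH.1, hH.2⟩

/-- **The sizes of the parameters at a good `X`.** [folklore] -/
theorem sizes {m c : ℕ} (hn : 1 ≤ n) (hm : 1 ≤ m) {X : ℝ} (h : GoodSize n m c X) :
    (Sq n m X : ℝ) ≤ Pw n m X ∧ Pw n m X / 4 ≤ Sq n m X ∧ 4 ≤ Sq n m X ∧
      (Dq n m X : ℝ) = aD n m * Sq n m X ∧ (bq n m X : ℝ) = cb n m * Sq n m X ∧
      (Mq X : ℝ) ≤ X ∧ (2 : ℝ) ≤ Mq X ∧ (Lq n m X : ℝ) ≤ scale ((m : ℝ) / n) 0 X ∧ (2 : ℝ) ≤ Lq n m X ∧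
      (Bq n m c X : ℝ) = aB n m c * Mq X ∧ (M2q n m c X : ℝ) = ((n : ℝ) + 1) * aB n m c * Mq X ∧
      (Sq n m X : ℝ) * (Mq X : ℝ) ^ m ≤ Om n m X ∧ Om n m X / 2 ^ (m + 2) ≤ (Sq n m X : ℝ) * (Mq X : ℝ) ^ m ∧
      Real.log (Mq X) ≤ Real.log X ∧ Real.log (Lq n m X) ≤ ((m : ℝ) / n) * Real.log X ∧
      Real.log (Sq n m X) ≤ (1 + (m : ℝ) / n) * Real.log X := by
  obtain ⟨hX1, hlog, hP1, hXP, hPXm, hOl, hPl, hPΦ, hPX, hPO, hΦΨ, hOΨ, hsP⟩ := atoms hn hm h.hX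
  have hX0 : 0 < X := by linarith
  have hMle : (Mq X : ℝ) ≤ X := M_le hX0.le
  have hLle : (Lq n m X : ℝ) ≤ scale ((m : ℝ) / n) 0 X := L_le hX1.le
  have hM2 : (2 : ℝ) ≤ Mq X := by exact_mod_cast h.M2
  have hL2 : (2 : ℝ) ≤ Lq n m X := by exact_mod_cast h.L2
  have hs0 : 0 ≤ scale ((m : ℝ) / n) 0 X := scale_nonneg hX1.le
  have hS : (Sq n m X : ℝ) = Lq n m X * Mq X := by unfold Sq; push_cast; ring
  have hSle : (Sq n m X : ℝ) ≤ Pw n m X := by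
    rw [hS, ← hsP]; exact mul_le_mul hLle hMle (Nat.cast_nonneg _) hs0
  have hSge : Pw n m X / 4 ≤ Sq n m X := by
    rw [hS, ← hsP]
    have := mul_le_mul h.Llo h.Mlo (by positivity) (Nat.cast_nonneg _)
    linarith
  have hS4 : 4 ≤ Sq n m X := by
    unfold Sq; calc 4 = 2 * 2 := by norm_num
      _ ≤ Lq n m X * Mq X := Nat.mul_le_mul h.L2 h.M2
  have hXm : (Mq X : ℝ) ^ m ≤ X ^ m := pow_le_pow_left₀ (Nat.cast_nonneg _) hMle m
  have hXm' : (X / 2) ^ m ≤ (Mq X : ℝ) ^ m := pow_le_pow_left₀ (by positivity) h.Mlo m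
  refine ⟨hSle, hSge, hS4, ?_, ?_, hMle, hM2, hLle, hL2, ?_, ?_, ?_, ?_, ?_, ?_, ?_⟩
  · unfold Dq; push_cast; ring
  · unfold bq; push_cast; ring
  · unfold Bq; push_cast; ring
  · unfold M2q Bq; push_cast; ring
  · rw [← hPXm]; exact mul_le_mul hSle hXm (by positivity) (by linarith)
  · rw [← hPXm]
    have h2 : (0 : ℝ) < 2 ^ m := by positivity
    calc Pw n m X * X ^ m / 2 ^ (m + 2) = (Pw n m X / 4) * (X / 2) ^ m := by
          rw [div_pow, pow_add]; field_simp; ring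
      _ ≤ (Sq n m X : ℝ) * (Mq X : ℝ) ^ m := mul_le_mul hSge hXm' (by positivity) (Nat.cast_nonneg _)
  · exact Real.log_le_log (by linarith) hMle
  · exact log_le_of_le_scale hX1 (by linarith) hLle
  · exact log_le_of_le_scale hX1 (by linarith) hSle

/-! ### Logarithms of the basic factors at a good `X` -/

section LogBounds

variable {m' c : ℕ} {X : ℝ}

/-- `log S! ≤ (1 + m/n) Φ`. [folklore] -/
theorem log_Sfact_le (hn : 1 ≤ n) (h : GoodSize n (m' + 1) c X) :
    Real.log ((Sq n (m' + 1) X).factorial : ℝ) ≤ (1 + (((m' + 1 : ℕ) : ℝ)) / n) * Phi3 n (m' + 1) X := by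
  have hm : 1 ≤ m' + 1 := Nat.succ_pos m'
  obtain ⟨hX1, hlog, hP1, -, -, -, hPl, -⟩ := atoms hn hm h.hX
  obtain ⟨hSle, -, hS4, -, -, -, -, -, -, -, -, -, -, -, -, hlogS⟩ := sizes hn hm h
  have hS0 : (0 : ℝ) ≤ Sq n (m' + 1) X := Nat.cast_nonneg _
  have hlS0 : 0 ≤ Real.log (Sq n (m' + 1) X) := Real.log_nonneg (by exact_mod_cast (show 1 ≤ Sq n (m' + 1) X by omega))
  calc Real.log ((Sq n (m' + 1) X).factorial : ℝ) ≤ Sq n (m' + 1) X * Real.log (Sq n (m' + 1) X) := log_factorial_le _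
    _ ≤ Pw n (m' + 1) X * ((1 + (((m' + 1 : ℕ) : ℝ)) / n) * Real.log X) := mul_le_mul hSle hlogS hlS0 (by linarith)
    _ = (1 + (((m' + 1 : ℕ) : ℝ)) / n) * Phi3 n (m' + 1) X := by rw [← hPl]; ring

/-- The constant of `log #AM ≤ K_AM Φ`: `K_AM = log a_D + 1 + m/n + m`. [folklore] -/
def KAM (n m : ℕ) : ℝ := Real.log (aD n m) + 1 + (m : ℝ) / n + m

/-- `log #AM ≤ K_AM Φ` (`#AM = DLⁿ`). [folklore] -/
theorem log_cardAM_le (hn : 1 ≤ n) (h : GoodSize n (m' + 1) c X) :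
    Real.log (Fintype.card (AM n (Dq n (m' + 1) X) (Lq n (m' + 1) X)) : ℝ) ≤ KAM n (m' + 1) * Phi3 n (m' + 1) X := by
  have hm : 1 ≤ m' + 1 := Nat.succ_pos m'
  obtain ⟨hX1, hlog, hP1, -, -, -, hPl, hPΦ, -⟩ := atoms hn hm h.hX
  obtain ⟨hSle, -, hS4, hD, -, -, -, -, hL2, -, -, -, -, -, hlogL, hlogS⟩ := sizes hn hm h
  have hcard : (Fintype.card (AM n (Dq n (m' + 1) X) (Lq n (m' + 1) X)) : ℝ) =
      (Dq n (m' + 1) X : ℝ) * (Lq n (m' + 1) X : ℝ) ^ n := by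
    simp only [Fintype.card_prod, Fintype.card_fin, Fintype.card_fun]; push_cast; ring
  have haD : (1 : ℝ) ≤ aD n (m' + 1) := by exact_mod_cast one_le_aD (n := n) (m := m' + 1)
  have hS1 : (1 : ℝ) ≤ Sq n (m' + 1) X := by exact_mod_cast (show 1 ≤ Sq n (m' + 1) X by omega)
  have hD1 : (1 : ℝ) ≤ Dq n (m' + 1) X := by rw [hD]; nlinarith
  have hlogD : Real.log (Dq n (m' + 1) X) ≤ Real.log (aD n (m' + 1)) + (1 + (((m' + 1 : ℕ) : ℝ)) / n) * Real.log X := by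
    rw [hD, Real.log_mul (by positivity) (by positivity)]; linarith
  have hn' : (n : ℝ) * (((((m' + 1 : ℕ) : ℝ)) / n) * Real.log X) = ((m' + 1 : ℕ) : ℝ) * Real.log X := by
    have : (n : ℝ) ≠ 0 := by exact_mod_cast (show n ≠ 0 by omega)
    field_simp
  have hlaD : 0 ≤ Real.log (aD n (m' + 1)) := Real.log_nonneg haD
  have hΦ1 : 1 ≤ Phi3 n (m' + 1) X := hP1.trans hPΦ
  have hlΦ : Real.log X ≤ Phi3 n (m' + 1) X := by
    calc Real.log X = 1 * Real.log X := (one_mul _).symm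
      _ ≤ Pw n (m' + 1) X * Real.log X := mul_le_mul_of_nonneg_right hP1 (by linarith)
      _ = Phi3 n (m' + 1) X := hPl
  rw [hcard, Real.log_mul (by positivity) (by positivity), Real.log_pow, KAM]
  have hmn : (0 : ℝ) ≤ (((m' + 1 : ℕ) : ℝ)) / n := by positivity
  calc Real.log (Dq n (m' + 1) X) + n * Real.log (Lq n (m' + 1) X)
      ≤ (Real.log (aD n (m' + 1)) + (1 + (((m' + 1 : ℕ) : ℝ)) / n) * Real.log X) +
          n * (((((m' + 1 : ℕ) : ℝ)) / n) * Real.log X) := by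
        gcongr
    _ = Real.log (aD n (m' + 1)) + (1 + (((m' + 1 : ℕ) : ℝ)) / n + ((m' + 1 : ℕ) : ℝ)) * Real.log X := by
        rw [hn']; ring
    _ ≤ Real.log (aD n (m' + 1)) * Phi3 n (m' + 1) X +
          (1 + (((m' + 1 : ℕ) : ℝ)) / n + ((m' + 1 : ℕ) : ℝ)) * Phi3 n (m' + 1) X := by
        gcongr
        · calc Real.log (aD n (m' + 1)) = Real.log (aD n (m' + 1)) * 1 := (mul_one _).symm
            _ ≤ _ := mul_le_mul_of_nonneg_left hΦ1 hlaD
    _ = (Real.log (aD n (m' + 1)) + 1 + (((m' + 1 : ℕ) : ℝ)) / n + ((m' + 1 : ℕ) : ℝ)) * Phi3 n (m' + 1) X := by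
        ring

/-- The constant of `log C ≤ K_C Φ`: `K_C = c_b #Var (log 2 + log A) + #Var (log c_b + 1 + m/n) + K_H`.
[folklore] -/
def KC (n m : ℕ) (A : ℝ) : ℝ :=
  cb n m * Fintype.card (Var n m) * (Real.log 2 + Real.log A) +
    Fintype.card (Var n m) * (Real.log (cb n m) + 1 + (m : ℝ) / n) + KH n m

/-- `log C ≤ K_C Φ` (`A ≥ 1`). [folklore] -/
theorem log_Ccoef_le (hn : 1 ≤ n) (h : GoodSize n (m' + 1) c X) {A : ℝ} (hA : 1 ≤ A) :
    Real.log (Ccoef n m' A X) ≤ KC n (m' + 1) A * Phi3 n (m' + 1) X := by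
  have hm : 1 ≤ m' + 1 := Nat.succ_pos m'
  obtain ⟨hX1, hlog, hP1, -, -, -, hPl, hPΦ, -⟩ := atoms hn hm h.hX
  obtain ⟨hSle, -, hS4, -, hb, -, -, -, -, -, -, -, -, -, -, hlogS⟩ := sizes hn hm h
  set V : ℕ := Fintype.card (Var n (m' + 1)) with hV
  set b : ℕ := bq n (m' + 1) X with hbdef
  have hcb : (2 : ℝ) ≤ cb n (m' + 1) := by exact_mod_cast two_le_cb (n := n) (m := m' + 1)
  have hS1 : (1 : ℝ) ≤ Sq n (m' + 1) X := by exact_mod_cast (show 1 ≤ Sq n (m' + 1) X by omega)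
  have hb1 : (1 : ℝ) ≤ b := by rw [hbdef, hb]; nlinarith
  have hbP : (b : ℝ) ≤ cb n (m' + 1) * Pw n (m' + 1) X := by
    rw [hbdef, hb]; exact mul_le_mul_of_nonneg_left hSle (by linarith)
  have hb1' : (((b - 1 : ℕ) : ℝ)) ≤ b := by exact_mod_cast Nat.sub_le b 1
  have hcardE : (Fintype.card (ExpIdx n (m' + 1) b) : ℝ) = (b : ℝ) ^ V := by
    simp only [Fintype.card_fun, Fintype.card_fin, hV]; push_cast; ring
  have hH1 := h.H1
  have hlogb : Real.log b ≤ Real.log (cb n (m' + 1)) + (1 + (((m' + 1 : ℕ) : ℝ)) / n) * Real.log X := by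
    rw [hbdef, hb, Real.log_mul (by positivity) (by positivity)]; linarith
  have hΦ1 : 1 ≤ Phi3 n (m' + 1) X := hP1.trans hPΦ
  have hΦ0 : 0 ≤ Phi3 n (m' + 1) X := by linarith
  have hlΦ : Real.log X ≤ Phi3 n (m' + 1) X := by
    calc Real.log X = 1 * Real.log X := (one_mul _).symm
      _ ≤ Pw n (m' + 1) X * Real.log X := mul_le_mul_of_nonneg_right hP1 (by linarith)
      _ = Phi3 n (m' + 1) X := hPl
  have hl2 : 0 ≤ Real.log 2 := Real.log_nonneg (by norm_num)
  have hlA : 0 ≤ Real.log A := Real.log_nonneg hA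
  have hlcb : 0 ≤ Real.log (cb n (m' + 1)) := Real.log_nonneg (by linarith)
  have hV0 : (0 : ℝ) ≤ V := Nat.cast_nonneg V
  unfold Ccoef
  rw [← hbdef, ← hV, hcardE, Real.log_mul (by positivity) (by positivity),
    Real.log_mul (by positivity) (by positivity), Real.log_mul (by positivity) (by positivity),
    Real.log_pow, Real.log_pow, Real.log_pow, KC, ← hV]
  push_cast
  -- the four terms
  have t1 : (((b - 1 : ℕ) : ℝ)) * V * Real.log 2 ≤ cb n (m' + 1) * V * Real.log 2 * Phi3 n (m' + 1) X := by
    have : (((b - 1 : ℕ) : ℝ)) ≤ cb n (m' + 1) * Phi3 n (m' + 1) X :=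
      hb1'.trans (hbP.trans (mul_le_mul_of_nonneg_left hPΦ (by linarith)))
    calc (((b - 1 : ℕ) : ℝ)) * V * Real.log 2 = (((b - 1 : ℕ) : ℝ)) * (V * Real.log 2) := by ring
      _ ≤ cb n (m' + 1) * Phi3 n (m' + 1) X * (V * Real.log 2) := mul_le_mul_of_nonneg_right this (by positivity)
      _ = _ := by ring
  have t2 : (V : ℝ) * Real.log b ≤ V * (Real.log (cb n (m' + 1)) + 1 + (((m' + 1 : ℕ) : ℝ)) / n) * Phi3 n (m' + 1) X := by
    have : Real.log b ≤ (Real.log (cb n (m' + 1)) + 1 + (((m' + 1 : ℕ) : ℝ)) / n) * Phi3 n (m' + 1) X := by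
      calc Real.log b ≤ Real.log (cb n (m' + 1)) + (1 + (((m' + 1 : ℕ) : ℝ)) / n) * Real.log X := hlogb
        _ ≤ Real.log (cb n (m' + 1)) * Phi3 n (m' + 1) X + (1 + (((m' + 1 : ℕ) : ℝ)) / n) * Phi3 n (m' + 1) X := by
            gcongr
            calc Real.log (cb n (m' + 1)) = Real.log (cb n (m' + 1)) * 1 := (mul_one _).symm
              _ ≤ _ := mul_le_mul_of_nonneg_left hΦ1 hlcb
        _ = _ := by ring
    calc (V : ℝ) * Real.log b ≤ V * ((Real.log (cb n (m' + 1)) + 1 + (((m' + 1 : ℕ) : ℝ)) / n) * Phi3 n (m' + 1) X) :=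
          mul_le_mul_of_nonneg_left this hV0
      _ = _ := by ring
  have t3 : Real.log (Hgt3 n (m' + 1) X) ≤ KH n (m' + 1) * Phi3 n (m' + 1) X := h.logH
  have t4 : (((b - 1 : ℕ) : ℝ)) * V * Real.log A ≤ cb n (m' + 1) * V * Real.log A * Phi3 n (m' + 1) X := by
    have : (((b - 1 : ℕ) : ℝ)) ≤ cb n (m' + 1) * Phi3 n (m' + 1) X :=
      hb1'.trans (hbP.trans (mul_le_mul_of_nonneg_left hPΦ (by linarith)))
    calc (((b - 1 : ℕ) : ℝ)) * V * Real.log A = (((b - 1 : ℕ) : ℝ)) * (V * Real.log A) := by ring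
      _ ≤ cb n (m' + 1) * Phi3 n (m' + 1) X * (V * Real.log A) := mul_le_mul_of_nonneg_right this (by positivity)
      _ = _ := by ring
  push_cast at t1 t2 t3 t4 ⊢
  linarith [t1, t2, t3, t4]

/-- The constant of `log κ ≤ -ρ + K_κ Φ`: `K_κ = log(3nm(n+1)a_B c_β) + 1 + m/n`. [folklore] -/
def KK (n m c : ℕ) (A : ℝ) : ℝ :=
  Real.log (3 * n * m * ((n : ℝ) + 1) * aB n m c * cbeta A) + 1 + (m : ℝ) / n

/-- `c_β ≥ 2`. [folklore] -/
theorem two_le_cbeta {A : ℝ} (hA : 1 ≤ A) : 2 ≤ cbeta A := by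
  unfold cbeta; have := Real.exp_pos (A ^ 2 + 1); nlinarith

/-- `κ = 3nm(n+1)a_B c_β · S · e^{-ρ}`. [folklore] -/
theorem kapX_eq (c : ℕ) (A X : ℝ) :
    kapX n m' c A X = (3 * n * ((m' + 1 : ℕ) : ℝ) * ((n : ℝ) + 1) * aB n (m' + 1) c * cbeta A) *
      Sq n (m' + 1) X * Real.exp (-rho3 n (m' + 1) X) := by
  unfold kapX M2q Bq Sq; push_cast; ring

/-- `log κ ≤ -ρ + K_κ Φ` (`n ≥ 1`, `A ≥ 1`). [folklore] -/
theorem log_kapX_le (hn : 1 ≤ n) (h : GoodSize n (m' + 1) c X) {A : ℝ} (hA : 1 ≤ A) :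
    Real.log (kapX n m' c A X) ≤ -rho3 n (m' + 1) X + KK n (m' + 1) c A * Phi3 n (m' + 1) X := by
  have hm : 1 ≤ m' + 1 := Nat.succ_pos m'
  obtain ⟨hX1, hlog, hP1, -, -, -, hPl, hPΦ, -⟩ := atoms hn hm h.hX
  obtain ⟨hSle, -, hS4, -, -, -, -, -, -, -, -, -, -, -, -, hlogS⟩ := sizes hn hm h
  have hn1 : (1 : ℝ) ≤ n := by exact_mod_cast hn
  have hm1 : (1 : ℝ) ≤ ((m' + 1 : ℕ) : ℝ) := by exact_mod_cast hm
  have haB : (1 : ℝ) ≤ aB n (m' + 1) c := by exact_mod_cast one_le_aB (n := n) (m := m' + 1) (c := c)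
  have hcβ := two_le_cbeta hA
  set K0 : ℝ := 3 * n * ((m' + 1 : ℕ) : ℝ) * ((n : ℝ) + 1) * aB n (m' + 1) c * cbeta A with hK0
  have hK01 : 1 ≤ K0 := by
    rw [hK0]
    have h1 : (1 : ℝ) ≤ 3 * n := by linarith
    have h2 : (1 : ℝ) ≤ 3 * n * ((m' + 1 : ℕ) : ℝ) := one_le_mul_of_one_le_of_one_le h1 hm1
    have h3 : (1 : ℝ) ≤ 3 * n * ((m' + 1 : ℕ) : ℝ) * ((n : ℝ) + 1) := one_le_mul_of_one_le_of_one_le h2 (by linarith)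
    have h4 : (1 : ℝ) ≤ 3 * n * ((m' + 1 : ℕ) : ℝ) * ((n : ℝ) + 1) * aB n (m' + 1) c :=
      one_le_mul_of_one_le_of_one_le h3 haB
    exact one_le_mul_of_one_le_of_one_le h4 (by linarith)
  have hS1 : (1 : ℝ) ≤ Sq n (m' + 1) X := by exact_mod_cast (show 1 ≤ Sq n (m' + 1) X by omega)
  have hΦ1 : 1 ≤ Phi3 n (m' + 1) X := hP1.trans hPΦ
  have hlΦ : Real.log X ≤ Phi3 n (m' + 1) X := by
    calc Real.log X = 1 * Real.log X := (one_mul _).symm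
      _ ≤ Pw n (m' + 1) X * Real.log X := mul_le_mul_of_nonneg_right hP1 (by linarith)
      _ = Phi3 n (m' + 1) X := hPl
  have hlK0 : 0 ≤ Real.log K0 := Real.log_nonneg hK01
  rw [kapX_eq, ← hK0, Real.log_mul (by positivity) (Real.exp_pos _).ne', Real.log_exp,
    Real.log_mul (by positivity) (by positivity), KK, ← hK0]
  have hmn : (0 : ℝ) ≤ 1 + (((m' + 1 : ℕ) : ℝ)) / n := by positivity
  calc Real.log K0 + Real.log (Sq n (m' + 1) X) + -rho3 n (m' + 1) X
      ≤ Real.log K0 * Phi3 n (m' + 1) X + (1 + (((m' + 1 : ℕ) : ℝ)) / n) * Phi3 n (m' + 1) X + -rho3 n (m' + 1) X := by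
        gcongr
        · calc Real.log K0 = Real.log K0 * 1 := (mul_one _).symm
            _ ≤ _ := mul_le_mul_of_nonneg_left hΦ1 hlK0
        · exact hlogS.trans (mul_le_mul_of_nonneg_left hlΦ hmn)
    _ = -rho3 n (m' + 1) X + (Real.log K0 + 1 + (((m' + 1 : ℕ) : ℝ)) / n) * Phi3 n (m' + 1) X := by ring

/-- The constant of `log ε̄ ≤ -ρ + K_ε Φ`. [folklore] -/
def Keps (n m c : ℕ) (A X0 Y0 : ℝ) : ℝ :=
  (1 + (m : ℝ) / n) + KAM n m + KC n m A + KK n m c A + aD n m * (Real.log (X0 + 1) + 1) + Y0 * (X0 + 1)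

/-- `0 < C`. [folklore] -/
theorem Ccoef_pos (h1 : 1 ≤ Hgt3 n (m' + 1) X) (hb : 1 ≤ bq n (m' + 1) X) {A : ℝ} (hA : 1 ≤ A) :
    0 < Ccoef n m' A X := by
  unfold Ccoef
  have : (1 : ℝ) ≤ Fintype.card (ExpIdx n (m' + 1) (bq n (m' + 1) X)) := by
    have : 1 ≤ Fintype.card (ExpIdx n (m' + 1) (bq n (m' + 1) X)) := by
      simp only [Fintype.card_fun, Fintype.card_fin]; exact Nat.one_le_pow _ _ hb
    exact_mod_cast this
  positivity

/-- `1 ≤ b` at a good `X`. [folklore] -/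
theorem one_le_bq (hn : 1 ≤ n) (h : GoodSize n (m' + 1) c X) : 1 ≤ bq n (m' + 1) X := by
  have hm : 1 ≤ m' + 1 := Nat.succ_pos m'
  obtain ⟨-, -, hS4, -, hb, -⟩ := sizes hn hm h
  have hcb : (2 : ℝ) ≤ cb n (m' + 1) := by exact_mod_cast two_le_cb (n := n) (m := m' + 1)
  have hS1 : (1 : ℝ) ≤ Sq n (m' + 1) X := by exact_mod_cast (show 1 ≤ Sq n (m' + 1) X by omega)
  have : (1 : ℝ) ≤ bq n (m' + 1) X := by rw [hb]; nlinarith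
  exact_mod_cast this

/-- `0 < #AM` at a good `X`. [folklore] -/
theorem cardAM_pos (hn : 1 ≤ n) (h : GoodSize n (m' + 1) c X) :
    (0 : ℝ) < Fintype.card (AM n (Dq n (m' + 1) X) (Lq n (m' + 1) X)) := by
  have hm : 1 ≤ m' + 1 := Nat.succ_pos m'
  obtain ⟨-, -, hS4, hD, -⟩ := sizes hn hm h
  have haD : (1 : ℝ) ≤ aD n (m' + 1) := by exact_mod_cast one_le_aD (n := n) (m := m' + 1)
  have hS1 : (1 : ℝ) ≤ Sq n (m' + 1) X := by exact_mod_cast (show 1 ≤ Sq n (m' + 1) X by omega)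
  have hD1 : (1 : ℝ) ≤ Dq n (m' + 1) X := by rw [hD]; nlinarith
  have : (Fintype.card (AM n (Dq n (m' + 1) X) (Lq n (m' + 1) X)) : ℝ) =
      (Dq n (m' + 1) X : ℝ) * (Lq n (m' + 1) X : ℝ) ^ n := by
    simp only [Fintype.card_prod, Fintype.card_fin, Fintype.card_fun]; push_cast; ring
  rw [this]; have : (2 : ℝ) ≤ Lq n (m' + 1) X := by exact_mod_cast h.L2
  positivity

/-- `0 < κ` (`n ≥ 1`, `A ≥ 1`). [folklore] -/
theorem kapX_pos (hn : 1 ≤ n) (h : GoodSize n (m' + 1) c X) {A : ℝ} (hA : 1 ≤ A) : 0 < kapX n m' c A X := by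
  have hm : 1 ≤ m' + 1 := Nat.succ_pos m'
  obtain ⟨-, -, hS4, -⟩ := sizes hn hm h
  rw [kapX_eq]; have := two_le_cbeta hA
  have : (0 : ℝ) < aB n (m' + 1) c := by
    exact_mod_cast lt_of_lt_of_le one_pos (one_le_aB (n := n) (m := m' + 1) (c := c))
  have : (0 : ℝ) < n := by exact_mod_cast hn
  have : (0 : ℝ) < Sq n (m' + 1) X := by exact_mod_cast (show 0 < Sq n (m' + 1) X by omega)
  positivity

/-- `0 < ε̄`. [folklore] -/
theorem epsJ_pos (hn : 1 ≤ n) (h : GoodSize n (m' + 1) c X) {A : ℝ} (hA : 1 ≤ A) (y : Fin n → ℂ)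
    (x : Fin (m' + 1) → ℂ) : 0 < epsJ n m' c y x A X := by
  have hC0 := Ccoef_pos h.H1 (one_le_bq hn h) hA
  have hκ0 := kapX_pos hn h hA
  have hAM0 := cardAM_pos hn h
  have hX00 : 0 < X0s x := by
    unfold X0s; have : 0 ≤ ∑ k, ‖x k‖ := Finset.sum_nonneg fun _ _ => norm_nonneg _; linarith
  unfold epsJ; positivity

/-- **`log ε̄ ≤ -ρ + K_ε Φ`** (the jets are small: `ε̄` carries the factor `κ ≍ e^{-ρ}`). [folklore] -/
theorem log_epsJ_le (hn : 1 ≤ n) (h : GoodSize n (m' + 1) c X) {A X0 Y0 : ℝ} (hA : 1 ≤ A)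
    (hX0 : 1 ≤ X0) (hY0 : 1 ≤ Y0) (y : Fin n → ℂ) (x : Fin (m' + 1) → ℂ) (hx0 : X0s x = X0) (hy0 : Y0s y = Y0) :
    Real.log (epsJ n m' c y x A X) ≤ -rho3 n (m' + 1) X + Keps n (m' + 1) c A X0 Y0 * Phi3 n (m' + 1) X := by
  have hm : 1 ≤ m' + 1 := Nat.succ_pos m'
  obtain ⟨hX1, hlog, hP1, -, -, -, hPl, hPΦ, -, -, -, -, hsP⟩ := atoms hn hm h.hX
  obtain ⟨hSle, -, hS4, hD, hb, hMle, -, hLle, -, -, -, -, -, -, -, -⟩ := sizes hn hm h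
  have hXpos : 0 < X := by linarith
  have hS1 : (1 : ℝ) ≤ Sq n (m' + 1) X := by exact_mod_cast (show 1 ≤ Sq n (m' + 1) X by omega)
  have haD : (1 : ℝ) ≤ aD n (m' + 1) := by exact_mod_cast one_le_aD (n := n) (m := m' + 1)
  have hcb : (2 : ℝ) ≤ cb n (m' + 1) := by exact_mod_cast two_le_cb (n := n) (m := m' + 1)
  have hC0 := Ccoef_pos h.H1 (one_le_bq hn h) hA
  have hκ0 := kapX_pos hn h hA
  have hAM0 := cardAM_pos hn h
  set r : ℝ := (Mq X : ℝ) * X0 + 1 with hr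
  have hMX0 : (0 : ℝ) ≤ (Mq X : ℝ) * X0 := by positivity
  have hr1 : 1 ≤ r := by rw [hr]; linarith
  have hrle : r ≤ (X0 + 1) * X := by rw [hr]; nlinarith
  have hlogr : Real.log r ≤ Real.log (X0 + 1) + Real.log X := by
    rw [← Real.log_mul (by positivity) (by positivity)]; exact Real.log_le_log (by linarith) hrle
  have hl01 : 0 ≤ Real.log (X0 + 1) := Real.log_nonneg (by linarith)
  -- the pieces
  have t1 := log_Sfact_le hn h
  have t2 := log_cardAM_le hn h
  have t3 := log_Ccoef_le hn h hA
  have t4 := log_kapX_le hn h hA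
  have t5 : (Dq n (m' + 1) X : ℝ) * Real.log r ≤ aD n (m' + 1) * (Real.log (X0 + 1) + 1) * Phi3 n (m' + 1) X := by
    have hDP : (Dq n (m' + 1) X : ℝ) ≤ aD n (m' + 1) * Pw n (m' + 1) X := by
      rw [hD]; exact mul_le_mul_of_nonneg_left hSle (by positivity)
    calc (Dq n (m' + 1) X : ℝ) * Real.log r ≤ (aD n (m' + 1) * Pw n (m' + 1) X) * (Real.log (X0 + 1) + Real.log X) :=
          mul_le_mul hDP hlogr (Real.log_nonneg hr1) (by positivity)
      _ = aD n (m' + 1) * (Pw n (m' + 1) X * Real.log (X0 + 1) + Phi3 n (m' + 1) X) := by rw [← hPl]; ring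
      _ ≤ aD n (m' + 1) * (Phi3 n (m' + 1) X * Real.log (X0 + 1) + Phi3 n (m' + 1) X) := by
          gcongr
      _ = _ := by ring
  have t6 : (Lq n (m' + 1) X : ℝ) * Y0 * r ≤ Y0 * (X0 + 1) * Phi3 n (m' + 1) X := by
    have hs0 : 0 ≤ scale ((((m' + 1 : ℕ) : ℝ)) / n) 0 X := scale_nonneg hX1.le
    calc (Lq n (m' + 1) X : ℝ) * Y0 * r ≤ scale ((((m' + 1 : ℕ) : ℝ)) / n) 0 X * Y0 * ((X0 + 1) * X) := by
          gcongr
      _ = Y0 * (X0 + 1) * (scale ((((m' + 1 : ℕ) : ℝ)) / n) 0 X * X) := by ring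
      _ = Y0 * (X0 + 1) * Pw n (m' + 1) X := by rw [hsP]
      _ ≤ Y0 * (X0 + 1) * Phi3 n (m' + 1) X := mul_le_mul_of_nonneg_left hPΦ (by positivity)
  unfold epsJ
  rw [hx0, hy0, ← hr, Real.log_mul (by positivity) (by positivity), Real.log_mul hAM0.ne' (by positivity),
    Real.log_mul (by positivity) (by positivity), Real.log_mul hC0.ne' hκ0.ne',
    Real.log_mul (by positivity) (Real.exp_pos _).ne', Real.log_exp, Real.log_pow, Keps]
  linarith [t1, t2, t3, t4, t5, t6]

/-- **`log 𝓗(t) ≤ -ρ + kΨ + K_Φ Φ + K_Ω Ω`** for the Hermite bound with our data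
(`N = M^m`, `S`, `ε = ε̄`, `r = r̄ = MX₀ + 1`, `δ = e^{-C_xM}/2`, `Λ₀ = Λ̄₀ = (δω₀^M)^{M^{m-1}}`),
whenever `log(2(t + r̄)) ≤ l_c + k log X`. [folklore] -/
theorem log_hermH_le (hn : 1 ≤ n) (h : GoodSize n (m' + 1) c X) {A X0 Y0 Cx : ℝ} (hA : 1 ≤ A)
    (hX0 : 1 ≤ X0) (hY0 : 1 ≤ Y0) (hCx : 0 ≤ Cx) (y : Fin n → ℂ) (x : Fin (m' + 1) → ℂ)
    (hx0 : X0s x = X0) (hy0 : Y0s y = Y0) (hω : 0 < omega0 x)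
    {t lc k : ℝ} (ht : 0 < t) (hlc : 0 ≤ lc) (hk : 0 ≤ k)
    (hlt : Real.log (2 * (t + ((Mq X : ℝ) * X0 + 1))) ≤ lc + k * Real.log X) :
    Real.log (hermH (Mq X ^ (m' + 1)) (Sq n (m' + 1) X) (epsJ n m' c y x A X) ((Mq X : ℝ) * X0 + 1)
        (Real.exp (-(Cx * Mq X)) / 2) (Lam0 m' x Cx X) t) ≤
      -rho3 n (m' + 1) X + k * Psi3 n (m' + 1) X +
        (((m' + 1 : ℕ) : ℝ) + (1 + (((m' + 1 : ℕ) : ℝ)) / n) + Keps n (m' + 1) c A X0 Y0 + 2 * Real.log 2) *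
          Phi3 n (m' + 1) X +
        (lc + 2 * Cx + Real.log 2 - Real.log (omega0 x)) * Om n (m' + 1) X := by
  have hm : 1 ≤ m' + 1 := Nat.succ_pos m'
  obtain ⟨hX1, hlog, hP1, -, -, hOl, hPl, hPΦ, -, hPO, -, -, -⟩ := atoms hn hm h.hX
  obtain ⟨hSle, -, hS4, -, -, hMle, hM2, -, -, -, -, hSN, -, hlogM, -, hlogS⟩ := sizes hn hm h
  have hXpos : 0 < X := by linarith
  have hS1 : (1 : ℝ) ≤ Sq n (m' + 1) X := by exact_mod_cast (show 1 ≤ Sq n (m' + 1) X by omega)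
  have hM1 : (1 : ℝ) ≤ Mq X := by linarith
  have hω1 : omega0 x ≤ 1 := min_le_left _ _
  have hlω : Real.log (omega0 x) ≤ 0 := Real.log_nonpos hω.le hω1
  set M : ℝ := (Mq X : ℝ) with hMdef
  set S : ℝ := (Sq n (m' + 1) X : ℝ) with hSdef
  set N : ℝ := ((Mq X ^ (m' + 1) : ℕ) : ℝ) with hNdef
  have hN : N = M ^ (m' + 1) := by rw [hNdef, hMdef]; push_cast; ring
  have hN0 : 0 < N := by rw [hN]; positivity
  set δ : ℝ := Real.exp (-(Cx * M)) / 2 with hδ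
  have hδ0 : 0 < δ := by positivity
  have hlogδ : Real.log δ = -(Cx * M) - Real.log 2 := by
    rw [hδ, Real.log_div (Real.exp_pos _).ne' (by norm_num), Real.log_exp]
  set Λ : ℝ := Lam0 m' x Cx X with hΛ
  have hΛeq : Λ = (δ * omega0 x ^ Mq X) ^ (Mq X ^ m') := by rw [hΛ, Lam0]
  have hΛ0 : 0 < Λ := by rw [hΛeq]; positivity
  have hlogΛ : Real.log Λ = M ^ m' * (Real.log δ + M * Real.log (omega0 x)) := by
    rw [hΛeq, Real.log_pow, Real.log_mul hδ0.ne' (by positivity), Real.log_pow, hMdef]; push_cast; ring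
  set ε : ℝ := epsJ n m' c y x A X with hε
  have hε0 : 0 < ε := epsJ_pos hn h hA y x
  have hlogε := log_epsJ_le hn h hA hX0 hY0 y x hx0 hy0
  rw [← hε] at hlogε
  have htr : 0 < 2 * (t + (M * X0 + 1)) := by positivity
  -- the logarithm of the Hermite bound
  have hH : hermH (Mq X ^ (m' + 1)) (Sq n (m' + 1) X) ε (M * X0 + 1) δ Λ t =
      N * S * ε * (2 * (t + (M * X0 + 1))) ^ (Sq n (m' + 1) X * Mq X ^ (m' + 1)) * (2 / δ) ^ Sq n (m' + 1) X /
        Λ ^ Sq n (m' + 1) X := by rw [hermH]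
  have hlogH : Real.log (hermH (Mq X ^ (m' + 1)) (Sq n (m' + 1) X) ε (M * X0 + 1) δ Λ t) =
      Real.log N + Real.log S + Real.log ε + (S * N) * Real.log (2 * (t + (M * X0 + 1))) +
        S * (Real.log 2 - Real.log δ) - S * Real.log Λ := by
    rw [hH, Real.log_div (by positivity) (by positivity), Real.log_mul (by positivity) (by positivity),
      Real.log_mul (by positivity) (by positivity), Real.log_mul (by positivity) (by positivity),
      Real.log_mul (by positivity) (by positivity), Real.log_pow, Real.log_pow, Real.log_pow,
      Real.log_div (by norm_num) hδ0.ne', hSdef, hNdef]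
    push_cast; ring
  rw [hlogH, hlogΛ, hlogδ]
  -- the six pieces
  have hΦ0 : 0 ≤ Phi3 n (m' + 1) X := by linarith
  have hO0 : 0 ≤ Om n (m' + 1) X := by linarith
  have p1 : Real.log N ≤ ((m' + 1 : ℕ) : ℝ) * Phi3 n (m' + 1) X := by
    rw [hN, Real.log_pow]
    have hlΦ : Real.log X ≤ Phi3 n (m' + 1) X := by
      calc Real.log X = 1 * Real.log X := (one_mul _).symm
        _ ≤ Pw n (m' + 1) X * Real.log X := mul_le_mul_of_nonneg_right hP1 (by linarith)
        _ = Phi3 n (m' + 1) X := hPl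
    push_cast
    exact mul_le_mul_of_nonneg_left (hlogM.trans hlΦ) (by positivity)
  have p2 : Real.log S ≤ (1 + (((m' + 1 : ℕ) : ℝ)) / n) * Phi3 n (m' + 1) X := by
    calc Real.log S ≤ (1 + (((m' + 1 : ℕ) : ℝ)) / n) * Real.log X := hlogS
      _ ≤ (1 + (((m' + 1 : ℕ) : ℝ)) / n) * Phi3 n (m' + 1) X := by
          refine mul_le_mul_of_nonneg_left ?_ (by positivity)
          calc Real.log X = 1 * Real.log X := (one_mul _).symm
            _ ≤ Pw n (m' + 1) X * Real.log X := mul_le_mul_of_nonneg_right hP1 (by linarith)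
            _ = Phi3 n (m' + 1) X := hPl
  have hSNO : S * N ≤ Om n (m' + 1) X := by rw [hN]; exact hSN
  have hSN0 : 0 ≤ S * N := by positivity
  have p4 : S * N * Real.log (2 * (t + (M * X0 + 1))) ≤ lc * Om n (m' + 1) X + k * Psi3 n (m' + 1) X := by
    calc S * N * Real.log (2 * (t + (M * X0 + 1))) ≤ S * N * (lc + k * Real.log X) :=
          mul_le_mul_of_nonneg_left hlt hSN0
      _ ≤ Om n (m' + 1) X * (lc + k * Real.log X) := mul_le_mul_of_nonneg_right hSNO (by positivity)
      _ = lc * Om n (m' + 1) X + k * (Om n (m' + 1) X * Real.log X) := by ring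
      _ = lc * Om n (m' + 1) X + k * Psi3 n (m' + 1) X := by rw [hOl]
  have hSM : S * M ≤ Om n (m' + 1) X := by
    calc S * M = S * M ^ 1 := by ring
      _ ≤ S * M ^ (m' + 1) := mul_le_mul_of_nonneg_left (pow_le_pow_right₀ hM1 hm) (by positivity)
      _ ≤ Om n (m' + 1) X := hSN
  have p5 : S * (Real.log 2 - (-(Cx * M) - Real.log 2)) ≤ 2 * Real.log 2 * Phi3 n (m' + 1) X + Cx * Om n (m' + 1) X := by
    have hl2 : 0 ≤ Real.log 2 := Real.log_nonneg (by norm_num)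
    have : S * (Real.log 2 - (-(Cx * M) - Real.log 2)) = 2 * Real.log 2 * S + Cx * (S * M) := by ring
    rw [this]
    gcongr
    · exact hSle.trans hPΦ
  have hSMm' : S * M ^ m' ≤ Om n (m' + 1) X := by
    calc S * M ^ m' ≤ S * M ^ (m' + 1) := mul_le_mul_of_nonneg_left (pow_le_pow_right₀ hM1 (Nat.le_succ _)) (by positivity)
      _ ≤ Om n (m' + 1) X := hSN
  have p6 : -(S * (M ^ m' * (-(Cx * M) - Real.log 2 + M * Real.log (omega0 x)))) ≤
      (Cx + Real.log 2 - Real.log (omega0 x)) * Om n (m' + 1) X := by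
    have e : -(S * (M ^ m' * (-(Cx * M) - Real.log 2 + M * Real.log (omega0 x)))) =
        Cx * (S * M ^ (m' + 1)) + Real.log 2 * (S * M ^ m') + (-Real.log (omega0 x)) * (S * M ^ (m' + 1)) := by ring
    rw [e]
    have hl2 : 0 ≤ Real.log 2 := Real.log_nonneg (by norm_num)
    have hnl : 0 ≤ -Real.log (omega0 x) := by linarith
    have a1 := mul_le_mul_of_nonneg_left hSN hCx
    have a2 := mul_le_mul_of_nonneg_left hSMm' hl2
    have a3 := mul_le_mul_of_nonneg_left hSN hnl
    linarith
  linarith [p1, p2, hlogε, p4, p5, p6]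

/-- `log(2(ρ̄₁ + 1 + r̄)) ≤ log(2((n+1)a_BX₀ + X₀ + 2)) + log X`. [folklore] -/
theorem log_two_t1_le (hn : 1 ≤ n) (h : GoodSize n (m' + 1) c X) {X0 : ℝ} (hX0 : 1 ≤ X0) :
    Real.log (2 * (((M2q n (m' + 1) c X : ℝ) * X0 + 1) + ((Mq X : ℝ) * X0 + 1))) ≤
      Real.log (2 * (((n : ℝ) + 1) * aB n (m' + 1) c * X0 + X0 + 2)) + 1 * Real.log X := by
  have hm : 1 ≤ m' + 1 := Nat.succ_pos m'
  obtain ⟨hX1, -⟩ := atoms hn hm h.hX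
  obtain ⟨-, -, -, -, -, hMle, -, -, -, -, hM2q, -⟩ := sizes hn hm h
  have hX0' : 0 < X := by linarith
  have haB : (1 : ℝ) ≤ aB n (m' + 1) c := by exact_mod_cast one_le_aB (n := n) (m := m' + 1) (c := c)
  have hle : 2 * (((M2q n (m' + 1) c X : ℝ) * X0 + 1) + ((Mq X : ℝ) * X0 + 1)) ≤
      (2 * (((n : ℝ) + 1) * aB n (m' + 1) c * X0 + X0 + 2)) * X := by
    rw [hM2q]
    have h1 : ((n : ℝ) + 1) * aB n (m' + 1) c * Mq X * X0 ≤ ((n : ℝ) + 1) * aB n (m' + 1) c * X * X0 := by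
      gcongr
    have h2 : (Mq X : ℝ) * X0 ≤ X * X0 := by gcongr
    nlinarith
  have hpos : 0 < 2 * (((M2q n (m' + 1) c X : ℝ) * X0 + 1) + ((Mq X : ℝ) * X0 + 1)) := by positivity
  calc Real.log (2 * (((M2q n (m' + 1) c X : ℝ) * X0 + 1) + ((Mq X : ℝ) * X0 + 1)))
      ≤ Real.log ((2 * (((n : ℝ) + 1) * aB n (m' + 1) c * X0 + X0 + 2)) * X) := Real.log_le_log hpos hle
    _ = _ := by rw [Real.log_mul (by positivity) hX0'.ne', one_mul]

/-- `log(2(R + r̄)) ≤ log(2(K_R + X₀ + 1)) + 2 log X`. [folklore] -/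
theorem log_two_t2_le (hn : 1 ≤ n) (h : GoodSize n (m' + 1) c X) {X0 K : ℝ} (hX0 : 1 ≤ X0) (hK : 0 < K) :
    Real.log (2 * (K * X ^ 2 + ((Mq X : ℝ) * X0 + 1))) ≤ Real.log (2 * (K + X0 + 1)) + 2 * Real.log X := by
  have hm : 1 ≤ m' + 1 := Nat.succ_pos m'
  obtain ⟨hX1, -⟩ := atoms hn hm h.hX
  obtain ⟨-, -, -, -, -, hMle, -⟩ := sizes hn hm h
  have hX0' : 0 < X := by linarith
  have hX2 : X ≤ X ^ 2 := by nlinarith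
  have h12 : (1 : ℝ) ≤ X ^ 2 := by nlinarith
  have hle : 2 * (K * X ^ 2 + ((Mq X : ℝ) * X0 + 1)) ≤ (2 * (K + X0 + 1)) * X ^ 2 := by
    have h2 : (Mq X : ℝ) * X0 ≤ X ^ 2 * X0 := by gcongr; linarith
    nlinarith
  have hpos : 0 < 2 * (K * X ^ 2 + ((Mq X : ℝ) * X0 + 1)) := by positivity
  calc Real.log (2 * (K * X ^ 2 + ((Mq X : ℝ) * X0 + 1)))
      ≤ Real.log ((2 * (K + X0 + 1)) * X ^ 2) := Real.log_le_log hpos hle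
    _ = _ := by rw [Real.log_mul (by positivity) (by positivity), Real.log_pow]; push_cast; ring

/-- `K_R ≥ 4`. [folklore] -/
theorem four_le_KR (c : ℕ) (x : Fin (m' + 1) → ℂ) : 4 ≤ KR n m' c x := by
  unfold KR
  have hX0 : 1 ≤ X0s x := by
    unfold X0s; have : 0 ≤ ∑ k, ‖x k‖ := Finset.sum_nonneg fun _ _ => norm_nonneg _; linarith
  have haB : (1 : ℝ) ≤ aB n (m' + 1) c := by exact_mod_cast one_le_aB (n := n) (m := m' + 1) (c := c)
  have hn0 : (0 : ℝ) ≤ n := Nat.cast_nonneg n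
  nlinarith [mul_nonneg (mul_nonneg (by linarith : (0 : ℝ) ≤ (n : ℝ) + 1) (by linarith : (0 : ℝ) ≤ aB n (m' + 1) c))
    (by linarith : (0 : ℝ) ≤ X0s x)]

/-- **`log B̄ ≤ (K_AM + K_C + a_D(log K_R + 2)) Φ + Y₀K_R Ω`.** [folklore] -/
theorem log_Bgr_le (hn : 1 ≤ n) (h : GoodSize n (m' + 1) c X) {A Y0 : ℝ} (hA : 1 ≤ A) (hY0 : 1 ≤ Y0)
    (y : Fin n → ℂ) (x : Fin (m' + 1) → ℂ) (hy0 : Y0s y = Y0) :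
    Real.log (Bgr n m' c y x A X) ≤
      (KAM n (m' + 1) + KC n (m' + 1) A + aD n (m' + 1) * (Real.log (KR n m' c x) + 2)) * Phi3 n (m' + 1) X +
        Y0 * KR n m' c x * Om n (m' + 1) X := by
  have hm : 1 ≤ m' + 1 := Nat.succ_pos m'
  obtain ⟨hX1, hlog, hP1, -, -, -, hPl, hPΦ, hPX, -, -, -, hsP⟩ := atoms hn hm h.hX
  obtain ⟨hSle, -, hS4, hD, -, -, -, hLle, -⟩ := sizes hn hm h
  have hXpos : 0 < X := by linarith
  have hK4 := four_le_KR (n := n) c x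
  set K : ℝ := KR n m' c x with hKdef
  have hK0 : 0 < K := by linarith
  have hlK : 0 ≤ Real.log K := Real.log_nonneg (by linarith)
  have haD : (1 : ℝ) ≤ aD n (m' + 1) := by exact_mod_cast one_le_aD (n := n) (m := m' + 1)
  have hC0 := Ccoef_pos h.H1 (one_le_bq hn h) hA
  have hAM0 := cardAM_pos hn h
  have t2 := log_cardAM_le hn h
  have t3 := log_Ccoef_le hn h hA
  have hDP : (Dq n (m' + 1) X : ℝ) ≤ aD n (m' + 1) * Pw n (m' + 1) X := by
    rw [hD]; exact mul_le_mul_of_nonneg_left hSle (by positivity)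
  have t5 : (Dq n (m' + 1) X : ℝ) * Real.log (K * X ^ 2) ≤ aD n (m' + 1) * (Real.log K + 2) * Phi3 n (m' + 1) X := by
    rw [Real.log_mul hK0.ne' (by positivity), Real.log_pow]; push_cast
    calc (Dq n (m' + 1) X : ℝ) * (Real.log K + 2 * Real.log X)
        ≤ (aD n (m' + 1) * Pw n (m' + 1) X) * (Real.log K + 2 * Real.log X) :=
          mul_le_mul_of_nonneg_right hDP (by positivity)
      _ = aD n (m' + 1) * (Pw n (m' + 1) X * Real.log K + 2 * Phi3 n (m' + 1) X) := by rw [← hPl]; ring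
      _ ≤ aD n (m' + 1) * (Phi3 n (m' + 1) X * Real.log K + 2 * Phi3 n (m' + 1) X) := by gcongr
      _ = _ := by ring
  have t6 : (Lq n (m' + 1) X : ℝ) * Y0 * (K * X ^ 2) ≤ Y0 * K * Om n (m' + 1) X := by
    have hs0 : 0 ≤ scale ((((m' + 1 : ℕ) : ℝ)) / n) 0 X := scale_nonneg hX1.le
    calc (Lq n (m' + 1) X : ℝ) * Y0 * (K * X ^ 2) ≤ scale ((((m' + 1 : ℕ) : ℝ)) / n) 0 X * Y0 * (K * X ^ 2) := by
          gcongr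
      _ = Y0 * K * ((scale ((((m' + 1 : ℕ) : ℝ)) / n) 0 X * X) * X) := by ring
      _ = Y0 * K * (Pw n (m' + 1) X * X) := by rw [hsP]
      _ ≤ Y0 * K * Om n (m' + 1) X := mul_le_mul_of_nonneg_left hPX (by positivity)
  unfold Bgr
  rw [hy0, ← hKdef, Real.log_mul hAM0.ne' (by positivity), Real.log_mul hC0.ne' (by positivity),
    Real.log_mul (by positivity) (Real.exp_pos _).ne', Real.log_exp, Real.log_pow]
  linarith [t2, t3, t5, t6]

/-- **The geometric factor**: if `2(X₀+1)X ≤ K_RX²` then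
`SM^m · log q̄ ≤ |log(2c₁/K_R)| Ω - Ψ/2^{m+2}` (`q̄ = (ρ̄₁+1+r̄)/(R-r̄)`, `c₁ = (n+1)a_BX₀ + X₀ + 2`).
[folklore] -/
theorem SN_log_qbar_le (hn : 1 ≤ n) (h : GoodSize n (m' + 1) c X) {X0 K : ℝ} (hX0 : 1 ≤ X0) (hK : 0 < K)
    (hq : 2 * ((X0 + 1) * X) ≤ K * X ^ 2) :
    0 < (((M2q n (m' + 1) c X : ℝ) * X0 + 1) + ((Mq X : ℝ) * X0 + 1)) / (K * X ^ 2 - ((Mq X : ℝ) * X0 + 1)) ∧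
    ((Sq n (m' + 1) X : ℝ) * (Mq X : ℝ) ^ (m' + 1)) *
        Real.log ((((M2q n (m' + 1) c X : ℝ) * X0 + 1) + ((Mq X : ℝ) * X0 + 1)) / (K * X ^ 2 - ((Mq X : ℝ) * X0 + 1))) ≤
      |Real.log (2 * (((n : ℝ) + 1) * aB n (m' + 1) c * X0 + X0 + 2) / K)| * Om n (m' + 1) X -
        Psi3 n (m' + 1) X / 2 ^ (m' + 3) := by
  have hm : 1 ≤ m' + 1 := Nat.succ_pos m'
  obtain ⟨hX1, hlog, -, -, -, hOl, -⟩ := atoms hn hm h.hX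
  obtain ⟨-, -, -, -, -, hMle, -, -, -, -, hM2q, hSN, hSNlo, -⟩ := sizes hn hm h
  have hXpos : 0 < X := by linarith
  have haB : (1 : ℝ) ≤ aB n (m' + 1) c := by exact_mod_cast one_le_aB (n := n) (m := m' + 1) (c := c)
  set c₁ : ℝ := ((n : ℝ) + 1) * aB n (m' + 1) c * X0 + X0 + 2 with hc₁
  have hc₁0 : 0 < c₁ := by rw [hc₁]; positivity
  -- numerator and denominator
  have hnum : ((M2q n (m' + 1) c X : ℝ) * X0 + 1) + ((Mq X : ℝ) * X0 + 1) ≤ c₁ * X := by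
    rw [hM2q, hc₁]
    have h1 : ((n : ℝ) + 1) * aB n (m' + 1) c * Mq X * X0 ≤ ((n : ℝ) + 1) * aB n (m' + 1) c * X * X0 := by gcongr
    have h2 : (Mq X : ℝ) * X0 ≤ X * X0 := by gcongr
    nlinarith
  have hnum0 : 0 < ((M2q n (m' + 1) c X : ℝ) * X0 + 1) + ((Mq X : ℝ) * X0 + 1) := by positivity
  have hr : (Mq X : ℝ) * X0 + 1 ≤ (X0 + 1) * X := by nlinarith
  have hden : K * X ^ 2 / 2 ≤ K * X ^ 2 - ((Mq X : ℝ) * X0 + 1) := by linarith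
  have hden0 : 0 < K * X ^ 2 / 2 := by positivity
  have hq0 : 0 < (((M2q n (m' + 1) c X : ℝ) * X0 + 1) + ((Mq X : ℝ) * X0 + 1)) / (K * X ^ 2 - ((Mq X : ℝ) * X0 + 1)) :=
    div_pos hnum0 (by linarith)
  refine ⟨hq0, ?_⟩
  have hqle : (((M2q n (m' + 1) c X : ℝ) * X0 + 1) + ((Mq X : ℝ) * X0 + 1)) / (K * X ^ 2 - ((Mq X : ℝ) * X0 + 1)) ≤
      (2 * c₁ / K) / X := by
    calc (((M2q n (m' + 1) c X : ℝ) * X0 + 1) + ((Mq X : ℝ) * X0 + 1)) / (K * X ^ 2 - ((Mq X : ℝ) * X0 + 1))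
        ≤ (c₁ * X) / (K * X ^ 2 / 2) := by
          calc _ ≤ (((M2q n (m' + 1) c X : ℝ) * X0 + 1) + ((Mq X : ℝ) * X0 + 1)) / (K * X ^ 2 / 2) :=
                div_le_div_of_nonneg_left hnum0.le hden0 hden
            _ ≤ (c₁ * X) / (K * X ^ 2 / 2) := div_le_div_of_nonneg_right hnum hden0.le
      _ = (2 * c₁ / K) / X := by field_simp
  have hlogq : Real.log ((((M2q n (m' + 1) c X : ℝ) * X0 + 1) + ((Mq X : ℝ) * X0 + 1)) /
      (K * X ^ 2 - ((Mq X : ℝ) * X0 + 1))) ≤ Real.log (2 * c₁ / K) - Real.log X := by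
    calc _ ≤ Real.log ((2 * c₁ / K) / X) := Real.log_le_log hq0 hqle
      _ = Real.log (2 * c₁ / K) - Real.log X := Real.log_div (by positivity) hXpos.ne'
  set SN : ℝ := (Sq n (m' + 1) X : ℝ) * (Mq X : ℝ) ^ (m' + 1) with hSNdef
  have hSN0 : 0 ≤ SN := by positivity
  calc SN * Real.log ((((M2q n (m' + 1) c X : ℝ) * X0 + 1) + ((Mq X : ℝ) * X0 + 1)) / (K * X ^ 2 - ((Mq X : ℝ) * X0 + 1)))
      ≤ SN * (Real.log (2 * c₁ / K) - Real.log X) := mul_le_mul_of_nonneg_left hlogq hSN0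
    _ = SN * Real.log (2 * c₁ / K) - SN * Real.log X := by ring
    _ ≤ |Real.log (2 * c₁ / K)| * Om n (m' + 1) X - (Om n (m' + 1) X / 2 ^ (m' + 1 + 2)) * Real.log X := by
        have a1 : SN * Real.log (2 * c₁ / K) ≤ |Real.log (2 * c₁ / K)| * Om n (m' + 1) X := by
          calc SN * Real.log (2 * c₁ / K) ≤ SN * |Real.log (2 * c₁ / K)| :=
                mul_le_mul_of_nonneg_left (le_abs_self _) hSN0
            _ ≤ Om n (m' + 1) X * |Real.log (2 * c₁ / K)| := mul_le_mul_of_nonneg_right hSN (abs_nonneg _)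
            _ = _ := mul_comm _ _
        have a2 : (Om n (m' + 1) X / 2 ^ (m' + 1 + 2)) * Real.log X ≤ SN * Real.log X :=
          mul_le_mul_of_nonneg_right hSNlo (by linarith)
        linarith
    _ = |Real.log (2 * c₁ / K)| * Om n (m' + 1) X - Psi3 n (m' + 1) X / 2 ^ (m' + 3) := by
        rw [← hOl, show m' + 1 + 2 = m' + 3 by omega]; ring

/-- `0 < hermH` for positive data. [folklore] -/
theorem hermH_pos {N S : ℕ} (hN : 0 < N) (hS : 0 < S) {ε r δ Λ₀ t : ℝ} (hε : 0 < ε) (htr : 0 < t + r)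
    (hδ : 0 < δ) (hΛ : 0 < Λ₀) : 0 < hermH N S ε r δ Λ₀ t := by
  unfold hermH
  have : (0 : ℝ) < N := by exact_mod_cast hN
  have : (0 : ℝ) < S := by exact_mod_cast hS
  positivity

/-- `0 < B̄`. [folklore] -/
theorem Bgr_pos (hn : 1 ≤ n) (h : GoodSize n (m' + 1) c X) {A : ℝ} (hA : 1 ≤ A) (y : Fin n → ℂ)
    (x : Fin (m' + 1) → ℂ) : 0 < Bgr n m' c y x A X := by
  have hC0 := Ccoef_pos h.H1 (one_le_bq hn h) hA
  have hAM0 := cardAM_pos hn h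
  have hK := four_le_KR (n := n) c x
  obtain ⟨hX1, -⟩ := atoms hn (Nat.succ_pos m') h.hX
  have hX0 : 0 < X := by linarith
  have : 0 < KR n m' c x * X ^ 2 := by positivity
  unfold Bgr; positivity

/-- `kΦ ≤ |k|(Φ + Ω)` and `kΩ ≤ |k|(Φ + Ω)` for `Φ, Ω ≥ 0`. [folklore] -/
theorem mul_le_abs_mul_add (k : ℝ) {Φ Ω : ℝ} (hΦ : 0 ≤ Φ) (hΩ : 0 ≤ Ω) :
    k * Φ ≤ |k| * (Φ + Ω) ∧ k * Ω ≤ |k| * (Φ + Ω) ∧ 0 ≤ |k| * (Φ + Ω) := by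
  refine ⟨?_, ?_, mul_nonneg (abs_nonneg k) (by linarith)⟩
  · calc k * Φ ≤ |k| * Φ := mul_le_mul_of_nonneg_right (le_abs_self k) hΦ
      _ ≤ |k| * (Φ + Ω) := mul_le_mul_of_nonneg_left (by linarith) (abs_nonneg k)
  · calc k * Ω ≤ |k| * Ω := mul_le_mul_of_nonneg_right (le_abs_self k) hΩ
      _ ≤ |k| * (Φ + Ω) := mul_le_mul_of_nonneg_left (by linarith) (abs_nonneg k)

/-- The constant `T_A` of the bound `termA ≤ 3 exp(T_A(Φ + Ω) - Ψ/2^{m+2})`. [folklore] -/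
def TA (n m' c : ℕ) (A X0 Y0 Cx ω K : ℝ) : ℝ :=
  (1 + (((m' + 1 : ℕ) : ℝ)) / n) +
  |(((m' + 1 : ℕ) : ℝ) + (1 + (((m' + 1 : ℕ) : ℝ)) / n) + Keps n (m' + 1) c A X0 Y0 + 2 * Real.log 2)| +
  |Real.log (2 * (((n : ℝ) + 1) * aB n (m' + 1) c * X0 + X0 + 2)) + 2 * Cx + Real.log 2 - Real.log ω| +
  |Real.log (2 * (K + X0 + 1)) + 2 * Cx + Real.log 2 - Real.log ω| +
  |KAM n (m' + 1) + KC n (m' + 1) A + aD n (m' + 1) * (Real.log K + 2)| + |Y0 * K| +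
  |Real.log (2 * (((n : ℝ) + 1) * aB n (m' + 1) c * X0 + X0 + 2) / K)|

set_option maxHeartbeats 800000 in
/-- **Term A is small**: `termA ≤ 3·exp(T_A(Φ + Ω) - Ψ/2^{m+2})` at a good `X` with
`2(X₀+1)X ≤ K_RX²`. [folklore] -/
theorem termA_le (hn : 1 ≤ n) (h : GoodSize n (m' + 1) c X) {Cx : ℝ} (hCx : 0 ≤ Cx)
    (y : Fin n → ℂ) (x : Fin (m' + 1) → ℂ) (hω : 0 < omega0 x)
    (hq : 2 * ((X0s x + 1) * X) ≤ KR n m' c x * X ^ 2) :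
    termA n m' c y x (Abd y x) Cx X ≤
      3 * Real.exp (TA n m' c (Abd y x) (X0s x) (Y0s y) Cx (omega0 x) (KR n m' c x) *
        (Phi3 n (m' + 1) X + Om n (m' + 1) X) - Psi3 n (m' + 1) X / 2 ^ (m' + 3)) := by
  have hm : 1 ≤ m' + 1 := Nat.succ_pos m'
  obtain ⟨hX1, hlog, hP1, -, -, hOl, hPl, hPΦ, -, hPO, hΦΨ, hOΨ, -⟩ := atoms hn hm h.hX
  obtain ⟨-, -, hS4, -, -, -, hM2, -⟩ := sizes hn hm h
  set A : ℝ := Abd y x with hAdef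
  set X0 : ℝ := X0s x with hX0def
  set Y0 : ℝ := Y0s y with hY0def
  set K : ℝ := KR n m' c x with hKdef
  set Φ : ℝ := Phi3 n (m' + 1) X with hΦdef
  set Ω : ℝ := Om n (m' + 1) X with hΩdef
  set Ψ : ℝ := Psi3 n (m' + 1) X with hΨdef
  have hA2 : 2 ≤ A := by
    rw [hAdef, Abd]; have : 0 ≤ ∑ v, ‖pt y x v‖ := Finset.sum_nonneg fun _ _ => norm_nonneg _; linarith
  have hA1 : 1 ≤ A := by linarith
  have hX01 : 1 ≤ X0 := by
    rw [hX0def, X0s]; have : 0 ≤ ∑ k, ‖x k‖ := Finset.sum_nonneg fun _ _ => norm_nonneg _; linarith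
  have hY01 : 1 ≤ Y0 := by
    rw [hY0def, Y0s]; have : 0 ≤ ∑ i, ‖y i‖ := Finset.sum_nonneg fun _ _ => norm_nonneg _; linarith
  have hK4 : 4 ≤ K := four_le_KR (n := n) c x
  have hK0 : 0 < K := by linarith
  have hΦ0 : 0 ≤ Φ := by rw [hΦdef]; linarith
  have hΩ0 : 0 ≤ Ω := by rw [hΩdef]; linarith
  have hΨ0 : 0 ≤ Ψ := by rw [hΨdef]; linarith
  have hρ : rho3 n (m' + 1) X = 4 * Ψ := by rw [hΨdef]; rfl
  -- the factors
  set Sf : ℝ := ((Sq n (m' + 1) X).factorial : ℝ) with hSf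
  have hSf0 : 0 < Sf := by rw [hSf]; exact_mod_cast Nat.factorial_pos _
  set ε : ℝ := epsJ n m' c y x A X with hε
  set rbar : ℝ := (Mq X : ℝ) * X0 + 1 with hrbar
  set δ : ℝ := Real.exp (-(Cx * Mq X)) / 2 with hδ
  set Λ : ℝ := Lam0 m' x Cx X with hΛ
  set t₁ : ℝ := (M2q n (m' + 1) c X : ℝ) * X0 + 1 with ht₁
  set R : ℝ := K * X ^ 2 with hR
  set H₁ : ℝ := hermH (Mq X ^ (m' + 1)) (Sq n (m' + 1) X) ε rbar δ Λ t₁ with hH₁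
  set HR : ℝ := hermH (Mq X ^ (m' + 1)) (Sq n (m' + 1) X) ε rbar δ Λ R with hHR
  set Bg : ℝ := Bgr n m' c y x A X with hBg
  set q : ℝ := (t₁ + rbar) / (R - rbar) with hqdef
  set SN : ℕ := Sq n (m' + 1) X * Mq X ^ (m' + 1) with hSNdef
  have hterm : termA n m' c y x A Cx X = Sf * (H₁ + (Bg + HR) * q ^ SN) := rfl
  -- positivity
  have hε0 : 0 < ε := epsJ_pos hn h hA1 y x
  have hδ0 : 0 < δ := by rw [hδ]; positivity
  have hΛ0 : 0 < Λ := by rw [hΛ, Lam0]; positivity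
  have hrbar0 : 0 < rbar := by rw [hrbar]; positivity
  have ht₁0 : 0 < t₁ := by rw [ht₁]; positivity
  have hR0 : 0 < R := by rw [hR]; positivity
  have hMpos : 0 < Mq X ^ (m' + 1) := pow_pos (lt_of_lt_of_le (by norm_num) h.M2) _
  have hSpos : 0 < Sq n (m' + 1) X := by omega
  have hH₁0 : 0 < H₁ := hermH_pos hMpos hSpos hε0 (by linarith) hδ0 hΛ0
  have hHR0 : 0 < HR := hermH_pos hMpos hSpos hε0 (by linarith) hδ0 hΛ0
  have hBg0 : 0 < Bg := Bgr_pos hn h hA1 y x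
  obtain ⟨hq0, hSNq⟩ := SN_log_qbar_le hn h hX01 hK0 hq
  rw [← ht₁, ← hrbar, ← hR, ← hqdef] at hq0 hSNq
  -- the logarithmic bounds
  have b0 := log_Sfact_le hn h
  have hc₁ : (1 : ℝ) ≤ 2 * (((n : ℝ) + 1) * aB n (m' + 1) c * X0 + X0 + 2) := by
    have : (0 : ℝ) ≤ ((n : ℝ) + 1) * aB n (m' + 1) c * X0 :=
      mul_nonneg (mul_nonneg (by positivity) (Nat.cast_nonneg _)) (by linarith)
    linarith
  have b1 := log_hermH_le hn h hA1 hX01 hY01 hCx y x hX0def.symm hY0def.symm hω ht₁0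
    (Real.log_nonneg hc₁) zero_le_one (log_two_t1_le hn h hX01)
  have b2 := log_hermH_le hn h hA1 hX01 hY01 hCx y x hX0def.symm hY0def.symm hω hR0
    (Real.log_nonneg (by linarith : (1 : ℝ) ≤ 2 * (K + X0 + 1)))
    (by norm_num : (0 : ℝ) ≤ 2) (log_two_t2_le hn h hX01 hK0)
  have b3 := log_Bgr_le hn h hA1 hY01 y x hY0def.symm
  rw [← hε, ← hrbar, ← hδ, ← hΛ, ← hH₁] at b1
  rw [← hε, ← hrbar, ← hδ, ← hΛ, ← hHR] at b2
  rw [← hBg, ← hKdef] at b3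
  -- abbreviations of the constants
  set a₀ : ℝ := 1 + (((m' + 1 : ℕ) : ℝ)) / n with ha₀
  set k₁ : ℝ := ((m' + 1 : ℕ) : ℝ) + (1 + (((m' + 1 : ℕ) : ℝ)) / n) + Keps n (m' + 1) c A X0 Y0 + 2 * Real.log 2 with hk₁
  set k₂ : ℝ := Real.log (2 * (((n : ℝ) + 1) * aB n (m' + 1) c * X0 + X0 + 2)) + 2 * Cx + Real.log 2 - Real.log (omega0 x) with hk₂
  set k₃ : ℝ := Real.log (2 * (K + X0 + 1)) + 2 * Cx + Real.log 2 - Real.log (omega0 x) with hk₃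
  set k₄ : ℝ := KAM n (m' + 1) + KC n (m' + 1) A + aD n (m' + 1) * (Real.log K + 2) with hk₄
  set k₅ : ℝ := Y0 * K with hk₅
  set k₆ : ℝ := |Real.log (2 * (((n : ℝ) + 1) * aB n (m' + 1) c * X0 + X0 + 2) / K)| with hk₆
  have hT : TA n m' c A X0 Y0 Cx (omega0 x) K = a₀ + |k₁| + |k₂| + |k₃| + |k₄| + |k₅| + k₆ := by
    rw [TA, ha₀, hk₁, hk₂, hk₃, hk₄, hk₅, hk₆]
  set U : ℝ := TA n m' c A X0 Y0 Cx (omega0 x) K * (Φ + Ω) - Ψ / 2 ^ (m' + 3) with hU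
  -- each exponent is `≤ U`
  have ha₀0 : 0 ≤ a₀ := by rw [ha₀]; positivity
  obtain ⟨e1, -, n1⟩ := mul_le_abs_mul_add k₁ hΦ0 hΩ0
  obtain ⟨-, e2, n2⟩ := mul_le_abs_mul_add k₂ hΦ0 hΩ0
  obtain ⟨-, e3, n3⟩ := mul_le_abs_mul_add k₃ hΦ0 hΩ0
  obtain ⟨e4, -, n4⟩ := mul_le_abs_mul_add k₄ hΦ0 hΩ0
  obtain ⟨-, e5, n5⟩ := mul_le_abs_mul_add k₅ hΦ0 hΩ0
  have hk₆0 : 0 ≤ k₆ := by rw [hk₆]; exact abs_nonneg _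
  have e6 : k₆ * Ω ≤ k₆ * (Φ + Ω) := mul_le_mul_of_nonneg_left (by linarith) hk₆0
  have n6 : 0 ≤ k₆ * (Φ + Ω) := mul_nonneg hk₆0 (by linarith)
  have e0 : a₀ * Φ ≤ a₀ * (Φ + Ω) := mul_le_mul_of_nonneg_left (by linarith) ha₀0
  have h2pow : Ψ / 2 ^ (m' + 3) ≤ Ψ := by
    rw [div_le_iff₀ (by positivity)]
    have : (1 : ℝ) ≤ 2 ^ (m' + 3) := one_le_pow₀ (by norm_num)
    calc Ψ = Ψ * 1 := (mul_one _).symm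
      _ ≤ Ψ * 2 ^ (m' + 3) := mul_le_mul_of_nonneg_left this hΨ0
  have hUexp : U = a₀ * (Φ + Ω) + |k₁| * (Φ + Ω) + |k₂| * (Φ + Ω) + |k₃| * (Φ + Ω) + |k₄| * (Φ + Ω) +
      |k₅| * (Φ + Ω) + k₆ * (Φ + Ω) - Ψ / 2 ^ (m' + 3) := by rw [hU, hT]; ring
  have U1 : a₀ * Φ + (-rho3 n (m' + 1) X + 1 * Ψ + k₁ * Φ + k₂ * Ω) ≤ U := by
    rw [hUexp, hρ]; linarith
  have U2 : a₀ * Φ + (k₄ * Φ + k₅ * Ω) + (k₆ * Ω - Ψ / 2 ^ (m' + 3)) ≤ U := by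
    rw [hUexp]; linarith
  have U3 : a₀ * Φ + (-rho3 n (m' + 1) X + 2 * Ψ + k₁ * Φ + k₃ * Ω) + (k₆ * Ω - Ψ / 2 ^ (m' + 3)) ≤ U := by
    rw [hUexp, hρ]; linarith
  -- exponential forms
  have xSf : Sf ≤ Real.exp (a₀ * Φ) := by
    rw [← Real.exp_log hSf0]; exact Real.exp_le_exp.mpr b0
  have xH₁ : H₁ ≤ Real.exp (-rho3 n (m' + 1) X + 1 * Ψ + k₁ * Φ + k₂ * Ω) := by
    rw [← Real.exp_log hH₁0]; exact Real.exp_le_exp.mpr b1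
  have xHR : HR ≤ Real.exp (-rho3 n (m' + 1) X + 2 * Ψ + k₁ * Φ + k₃ * Ω) := by
    rw [← Real.exp_log hHR0]; exact Real.exp_le_exp.mpr b2
  have xBg : Bg ≤ Real.exp (k₄ * Φ + k₅ * Ω) := by
    rw [← Real.exp_log hBg0]; exact Real.exp_le_exp.mpr b3
  have xq : q ^ SN ≤ Real.exp (k₆ * Ω - Ψ / 2 ^ (m' + 3)) := by
    have hqpow : q ^ SN = Real.exp (Real.log q * SN) := by
      rw [← Real.rpow_def_of_pos hq0, Real.rpow_natCast]
    rw [hqpow]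
    refine Real.exp_le_exp.mpr ?_
    rw [hSNdef]; push_cast
    calc Real.log q * ((Sq n (m' + 1) X : ℝ) * (Mq X : ℝ) ^ (m' + 1))
        = ((Sq n (m' + 1) X : ℝ) * (Mq X : ℝ) ^ (m' + 1)) * Real.log q := mul_comm _ _
      _ ≤ k₆ * Ω - Ψ / 2 ^ (m' + 3) := by rw [hk₆]; exact hSNq
  have hqSN0 : 0 ≤ q ^ SN := pow_nonneg hq0.le _
  have P1 : Sf * H₁ ≤ Real.exp U := by
    calc Sf * H₁ ≤ Real.exp (a₀ * Φ) * Real.exp (-rho3 n (m' + 1) X + 1 * Ψ + k₁ * Φ + k₂ * Ω) :=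
          mul_le_mul xSf xH₁ hH₁0.le (Real.exp_pos _).le
      _ = Real.exp (a₀ * Φ + (-rho3 n (m' + 1) X + 1 * Ψ + k₁ * Φ + k₂ * Ω)) := (Real.exp_add _ _).symm
      _ ≤ Real.exp U := Real.exp_le_exp.mpr U1
  have P2 : Sf * Bg * q ^ SN ≤ Real.exp U := by
    calc Sf * Bg * q ^ SN ≤ Real.exp (a₀ * Φ) * Real.exp (k₄ * Φ + k₅ * Ω) * Real.exp (k₆ * Ω - Ψ / 2 ^ (m' + 3)) :=
          mul_le_mul (mul_le_mul xSf xBg hBg0.le (Real.exp_pos _).le) xq hqSN0 (by positivity)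
      _ = Real.exp (a₀ * Φ + (k₄ * Φ + k₅ * Ω) + (k₆ * Ω - Ψ / 2 ^ (m' + 3))) := by
          rw [← Real.exp_add, ← Real.exp_add]
      _ ≤ Real.exp U := Real.exp_le_exp.mpr U2
  have P3 : Sf * HR * q ^ SN ≤ Real.exp U := by
    calc Sf * HR * q ^ SN ≤ Real.exp (a₀ * Φ) * Real.exp (-rho3 n (m' + 1) X + 2 * Ψ + k₁ * Φ + k₃ * Ω) *
          Real.exp (k₆ * Ω - Ψ / 2 ^ (m' + 3)) :=
          mul_le_mul (mul_le_mul xSf xHR hHR0.le (Real.exp_pos _).le) xq hqSN0 (by positivity)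
      _ = Real.exp (a₀ * Φ + (-rho3 n (m' + 1) X + 2 * Ψ + k₁ * Φ + k₃ * Ω) + (k₆ * Ω - Ψ / 2 ^ (m' + 3))) := by
          rw [← Real.exp_add, ← Real.exp_add]
      _ ≤ Real.exp U := Real.exp_le_exp.mpr U3
  calc termA n m' c y x A Cx X = Sf * H₁ + Sf * Bg * q ^ SN + Sf * HR * q ^ SN := by rw [hterm]; ring
    _ ≤ Real.exp U + Real.exp U + Real.exp U := by linarith
    _ = 3 * Real.exp U := by ring

/-- The constant `T_B` of `log termB ≤ -ρ + T_B Φ`. [folklore] -/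
def TB (n m' c : ℕ) (A X0 Y0 : ℝ) : ℝ :=
  (1 + (((m' + 1 : ℕ) : ℝ)) / n) + KAM n (m' + 1) + KC n (m' + 1) A + KK n (m' + 1) c A +
    aD n (m' + 1) * (Real.log (((n : ℝ) + 1) * aB n (m' + 1) c * X0 + 2) + 1) +
    Y0 * (((n : ℝ) + 1) * aB n (m' + 1) c * X0 + 2)

/-- **Term B is small**: `termB ≤ exp(-ρ + T_B Φ)` at a good `X`. [folklore] -/
theorem termB_le (hn : 1 ≤ n) (h : GoodSize n (m' + 1) c X) (y : Fin n → ℂ) (x : Fin (m' + 1) → ℂ) :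
    termB n m' c y x (Abd y x) X ≤
      Real.exp (-rho3 n (m' + 1) X + TB n m' c (Abd y x) (X0s x) (Y0s y) * Phi3 n (m' + 1) X) := by
  have hm : 1 ≤ m' + 1 := Nat.succ_pos m'
  obtain ⟨hX1, hlog, hP1, -, -, -, hPl, hPΦ, -, -, -, -, hsP⟩ := atoms hn hm h.hX
  obtain ⟨hSle, -, hS4, hD, -, hMle, -, hLle, -, -, hM2q, -⟩ := sizes hn hm h
  set A : ℝ := Abd y x with hAdef
  set X0 : ℝ := X0s x with hX0def
  set Y0 : ℝ := Y0s y with hY0def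
  have hA1 : 1 ≤ A := by
    rw [hAdef, Abd]; have : 0 ≤ ∑ v, ‖pt y x v‖ := Finset.sum_nonneg fun _ _ => norm_nonneg _; linarith
  have hX01 : 1 ≤ X0 := by
    rw [hX0def, X0s]; have : 0 ≤ ∑ k, ‖x k‖ := Finset.sum_nonneg fun _ _ => norm_nonneg _; linarith
  have hY01 : 1 ≤ Y0 := by
    rw [hY0def, Y0s]; have : 0 ≤ ∑ i, ‖y i‖ := Finset.sum_nonneg fun _ _ => norm_nonneg _; linarith
  have hXpos : 0 < X := by linarith
  have haD : (1 : ℝ) ≤ aD n (m' + 1) := by exact_mod_cast one_le_aD (n := n) (m := m' + 1)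
  have haB : (0 : ℝ) ≤ aB n (m' + 1) c := Nat.cast_nonneg _
  set c₃ : ℝ := ((n : ℝ) + 1) * aB n (m' + 1) c * X0 + 2 with hc₃
  have hc₃1 : 1 ≤ c₃ := by
    rw [hc₃]; have : (0 : ℝ) ≤ ((n : ℝ) + 1) * aB n (m' + 1) c * X0 := by positivity
    linarith
  set t₁ : ℝ := (M2q n (m' + 1) c X : ℝ) * X0 + 1 with ht₁
  have ht₁0 : 0 < t₁ := by rw [ht₁]; positivity
  have ht₁le : t₁ ≤ c₃ * X := by
    rw [ht₁, hM2q, hc₃]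
    have h1 : ((n : ℝ) + 1) * aB n (m' + 1) c * Mq X * X0 ≤ ((n : ℝ) + 1) * aB n (m' + 1) c * X * X0 := by gcongr
    nlinarith
  have hlogt₁ : Real.log t₁ ≤ Real.log c₃ + Real.log X := by
    rw [← Real.log_mul (by positivity) hXpos.ne']; exact Real.log_le_log ht₁0 ht₁le
  have hlc₃ : 0 ≤ Real.log c₃ := Real.log_nonneg hc₃1
  -- positivity of the factors
  have hC0 := Ccoef_pos h.H1 (one_le_bq hn h) hA1
  have hκ0 := kapX_pos hn h hA1
  have hAM0 := cardAM_pos hn h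
  have hSf0 : (0 : ℝ) < ((Sq n (m' + 1) X).factorial : ℝ) := by exact_mod_cast Nat.factorial_pos _
  -- the pieces
  have b0 := log_Sfact_le hn h
  have b2 := log_cardAM_le hn h
  have b3 := log_Ccoef_le hn h hA1
  have b4 := log_kapX_le hn h hA1
  have hDP : (Dq n (m' + 1) X : ℝ) ≤ aD n (m' + 1) * Pw n (m' + 1) X := by
    rw [hD]; exact mul_le_mul_of_nonneg_left hSle (by positivity)
  have b5 : (Dq n (m' + 1) X : ℝ) * Real.log t₁ ≤ aD n (m' + 1) * (Real.log c₃ + 1) * Phi3 n (m' + 1) X := by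
    calc (Dq n (m' + 1) X : ℝ) * Real.log t₁ ≤ (aD n (m' + 1) * Pw n (m' + 1) X) * (Real.log c₃ + Real.log X) :=
          mul_le_mul hDP hlogt₁ (Real.log_nonneg (by rw [ht₁]; linarith [(by positivity : (0:ℝ) ≤ (M2q n (m' + 1) c X : ℝ) * X0)])) (by positivity)
      _ = aD n (m' + 1) * (Pw n (m' + 1) X * Real.log c₃ + Phi3 n (m' + 1) X) := by rw [← hPl]; ring
      _ ≤ aD n (m' + 1) * (Phi3 n (m' + 1) X * Real.log c₃ + Phi3 n (m' + 1) X) := by gcongr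
      _ = _ := by ring
  have b6 : (Lq n (m' + 1) X : ℝ) * Y0 * t₁ ≤ Y0 * c₃ * Phi3 n (m' + 1) X := by
    have hs0 : 0 ≤ scale ((((m' + 1 : ℕ) : ℝ)) / n) 0 X := scale_nonneg hX1.le
    calc (Lq n (m' + 1) X : ℝ) * Y0 * t₁ ≤ scale ((((m' + 1 : ℕ) : ℝ)) / n) 0 X * Y0 * (c₃ * X) := by gcongr
      _ = Y0 * c₃ * (scale ((((m' + 1 : ℕ) : ℝ)) / n) 0 X * X) := by ring
      _ = Y0 * c₃ * Pw n (m' + 1) X := by rw [hsP]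
      _ ≤ Y0 * c₃ * Phi3 n (m' + 1) X := mul_le_mul_of_nonneg_left hPΦ (by positivity)
  have hlogB : Real.log (termB n m' c y x A X) ≤ -rho3 n (m' + 1) X + TB n m' c A X0 Y0 * Phi3 n (m' + 1) X := by
    unfold termB
    rw [← hX0def, ← hY0def, ← ht₁, Real.log_mul hSf0.ne' (by positivity), Real.log_mul hAM0.ne' (by positivity),
      Real.log_mul (by positivity) (by positivity), Real.log_mul hC0.ne' hκ0.ne',
      Real.log_mul (by positivity) (Real.exp_pos _).ne', Real.log_exp, Real.log_pow, TB, ← hc₃]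
    linarith [b0, b2, b3, b4, b5, b6]
  have hpos : 0 < termB n m' c y x A X := by unfold termB; rw [← ht₁]; positivity
  rw [← Real.exp_log hpos]
  exact Real.exp_le_exp.mpr hlogB

/-- The constant `K_T` of `T̄ ≤ K_T P`: `K_T = c_b #Var + 1 + a_D + nm((n+1)a_B + 1)`. [folklore] -/
def KT (n m' c : ℕ) : ℝ :=
  cb n (m' + 1) * Fintype.card (Var n (m' + 1)) + 1 + aD n (m' + 1) +
    n * ((m' + 1 : ℕ) : ℝ) * (((n : ℝ) + 1) * aB n (m' + 1) c + 1)

/-- The constant `T_C` of `log termC ≤ -ρ + T_C Φ`. [folklore] -/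
def TC (n m' c : ℕ) (A : ℝ) : ℝ :=
  KAM n (m' + 1) + KC n (m' + 1) A + (Real.log (aD n (m' + 1) + n) + 1 + (((m' + 1 : ℕ) : ℝ)) / n) +
    aD n (m' + 1) * (Real.log (((m' + 1 : ℕ) : ℝ) * (((n : ℝ) + 1) * aB n (m' + 1) c + 1) + 1) + 1) +
    (Real.log (KT n m' c) + 1 + (((m' + 1 : ℕ) : ℝ)) / n) + KT n m' c * Real.log A

set_option maxHeartbeats 800000 in
/-- **Term C is small**: `termC ≤ exp(-ρ + T_C Φ)` at a good `X` (`A ≥ 1`). [folklore] -/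
theorem termC_le (hn : 1 ≤ n) (h : GoodSize n (m' + 1) c X) {A : ℝ} (hA : 1 ≤ A) :
    termC n m' c A X ≤ Real.exp (-rho3 n (m' + 1) X + TC n m' c A * Phi3 n (m' + 1) X) := by
  have hm : 1 ≤ m' + 1 := Nat.succ_pos m'
  obtain ⟨hX1, hlog, hP1, -, -, -, hPl, hPΦ, -, -, -, -, hsP⟩ := atoms hn hm h.hX
  obtain ⟨hSle, -, hS4, hD, hb, hMle, -, hLle, hL2, -, hM2q, -⟩ := sizes hn hm h
  have hXpos : 0 < X := by linarith
  have haD : (1 : ℝ) ≤ aD n (m' + 1) := by exact_mod_cast one_le_aD (n := n) (m := m' + 1)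
  have haB : (0 : ℝ) ≤ aB n (m' + 1) c := Nat.cast_nonneg _
  have hcb : (2 : ℝ) ≤ cb n (m' + 1) := by exact_mod_cast two_le_cb (n := n) (m := m' + 1)
  have hS1 : (1 : ℝ) ≤ Sq n (m' + 1) X := by exact_mod_cast (show 1 ≤ Sq n (m' + 1) X by omega)
  have hn1 : (1 : ℝ) ≤ n := by exact_mod_cast hn
  have hm1 : (1 : ℝ) ≤ ((m' + 1 : ℕ) : ℝ) := by exact_mod_cast hm
  set V : ℕ := Fintype.card (Var n (m' + 1)) with hV
  set P : ℝ := Pw n (m' + 1) X with hPdef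
  set Φ : ℝ := Phi3 n (m' + 1) X with hΦdef
  have hP0 : 0 < P := by linarith
  have hΦ1 : 1 ≤ Φ := hP1.trans hPΦ
  have hlΦ : Real.log X ≤ Φ := by
    calc Real.log X = 1 * Real.log X := (one_mul _).symm
      _ ≤ P * Real.log X := mul_le_mul_of_nonneg_right hP1 (by linarith)
      _ = Φ := hPl
  have hlogP : Real.log P = (1 + (((m' + 1 : ℕ) : ℝ)) / n) * Real.log X := by
    rw [hPdef, Pw, scale_zero_eq_exp _ hXpos, Real.log_exp]
  have hsP' : scale ((((m' + 1 : ℕ) : ℝ)) / n) 0 X ≤ P := by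
    rw [hPdef, Pw]; exact scale_le_scale (by linarith) le_rfl h.hX
  -- (1) `#AM`
  have hAM0 := cardAM_pos hn h
  have b1 := log_cardAM_le hn h
  -- (2) `2^{(b-1)V} #ExpIdx H ≤ C`
  have hC0 := Ccoef_pos h.H1 (one_le_bq hn h) hA
  have hpart0 : 0 < (2 : ℝ) ^ ((bq n (m' + 1) X - 1) * V) *
      (Fintype.card (ExpIdx n (m' + 1) (bq n (m' + 1) X)) * Hgt3 n (m' + 1) X) := by
    have : (1 : ℝ) ≤ Fintype.card (ExpIdx n (m' + 1) (bq n (m' + 1) X)) := by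
      have : 1 ≤ Fintype.card (ExpIdx n (m' + 1) (bq n (m' + 1) X)) := by
        simp only [Fintype.card_fun, Fintype.card_fin]; exact Nat.one_le_pow _ _ (one_le_bq hn h)
      exact_mod_cast this
    have := h.H1; positivity
  have b2 : Real.log ((2 : ℝ) ^ ((bq n (m' + 1) X - 1) * V) *
      (Fintype.card (ExpIdx n (m' + 1) (bq n (m' + 1) X)) * Hgt3 n (m' + 1) X)) ≤ KC n (m' + 1) A * Φ := by
    refine le_trans (Real.log_le_log hpart0 ?_) (log_Ccoef_le hn h hA)
    unfold Ccoef; rw [← hV]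
    calc _ = (2 : ℝ) ^ ((bq n (m' + 1) X - 1) * V) *
          (Fintype.card (ExpIdx n (m' + 1) (bq n (m' + 1) X)) * Hgt3 n (m' + 1) X) * 1 := (mul_one _).symm
      _ ≤ _ := mul_le_mul_of_nonneg_left (one_le_pow₀ hA) hpart0.le
  -- (3) `S log(D + nL)`
  have hDnL : ((Dq n (m' + 1) X : ℝ)) + n * Lq n (m' + 1) X ≤ (aD n (m' + 1) + n) * P := by
    rw [hD]
    have h1 : (aD n (m' + 1) : ℝ) * Sq n (m' + 1) X ≤ aD n (m' + 1) * P := mul_le_mul_of_nonneg_left hSle (by positivity)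
    have h2 : (n : ℝ) * Lq n (m' + 1) X ≤ n * P := mul_le_mul_of_nonneg_left (hLle.trans hsP') (by positivity)
    linarith
  have hDnL1 : (1 : ℝ) ≤ ((Dq n (m' + 1) X : ℝ)) + n * Lq n (m' + 1) X := by
    have : (1 : ℝ) ≤ Dq n (m' + 1) X := by rw [hD]; nlinarith
    have : (0 : ℝ) ≤ n * Lq n (m' + 1) X := by positivity
    linarith
  have hlDnL : Real.log (((Dq n (m' + 1) X : ℝ)) + n * Lq n (m' + 1) X) ≤
      Real.log (aD n (m' + 1) + n) + (1 + (((m' + 1 : ℕ) : ℝ)) / n) * Real.log X := by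
    rw [← hlogP, ← Real.log_mul (by positivity) hP0.ne']
    exact Real.log_le_log (by linarith) hDnL
  have hlaDn : 0 ≤ Real.log (aD n (m' + 1) + n) := Real.log_nonneg (by linarith)
  have b3 : (Sq n (m' + 1) X : ℝ) * Real.log (((Dq n (m' + 1) X : ℝ)) + n * Lq n (m' + 1) X) ≤
      (Real.log (aD n (m' + 1) + n) + 1 + (((m' + 1 : ℕ) : ℝ)) / n) * Φ := by
    calc (Sq n (m' + 1) X : ℝ) * Real.log (((Dq n (m' + 1) X : ℝ)) + n * Lq n (m' + 1) X)
        ≤ P * (Real.log (aD n (m' + 1) + n) + (1 + (((m' + 1 : ℕ) : ℝ)) / n) * Real.log X) :=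
          mul_le_mul hSle hlDnL (Real.log_nonneg hDnL1) hP0.le
      _ = P * Real.log (aD n (m' + 1) + n) + (1 + (((m' + 1 : ℕ) : ℝ)) / n) * Φ := by rw [← hPl]; ring
      _ ≤ Φ * Real.log (aD n (m' + 1) + n) + (1 + (((m' + 1 : ℕ) : ℝ)) / n) * Φ := by gcongr
      _ = _ := by ring
  -- (4) `D log(m(M₂+1)+1)`
  set c₄ : ℝ := ((m' + 1 : ℕ) : ℝ) * (((n : ℝ) + 1) * aB n (m' + 1) c + 1) + 1 with hc₄
  have hc₄1 : 1 ≤ c₄ := by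
    rw [hc₄]; linarith [(by positivity : (0 : ℝ) ≤ ((m' + 1 : ℕ) : ℝ) * (((n : ℝ) + 1) * aB n (m' + 1) c + 1))]
  have hMM : (((m' + 1 : ℕ) : ℝ)) * ((M2q n (m' + 1) c X + 1 : ℕ) : ℝ) + 1 ≤ c₄ * X := by
    have hc : ((M2q n (m' + 1) c X + 1 : ℕ) : ℝ) = (M2q n (m' + 1) c X : ℝ) + 1 := by push_cast; ring
    rw [hc, hM2q, hc₄]
    have h1 : ((n : ℝ) + 1) * aB n (m' + 1) c * Mq X ≤ ((n : ℝ) + 1) * aB n (m' + 1) c * X := by gcongr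
    have h2 : (1 : ℝ) ≤ X := hX1.le
    have h3 : (0 : ℝ) ≤ ((m' + 1 : ℕ) : ℝ) := Nat.cast_nonneg _
    have h4 : ((n : ℝ) + 1) * aB n (m' + 1) c * Mq X + 1 ≤ (((n : ℝ) + 1) * aB n (m' + 1) c + 1) * X := by
      nlinarith
    have h5 := mul_le_mul_of_nonneg_left h4 h3
    have h6 : (((m' + 1 : ℕ) : ℝ)) * ((((n : ℝ) + 1) * aB n (m' + 1) c + 1) * X) + 1 ≤
        ((((m' + 1 : ℕ) : ℝ)) * (((n : ℝ) + 1) * aB n (m' + 1) c + 1) + 1) * X := by nlinarith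
    linarith
  have hMM0 : 0 < (((m' + 1 : ℕ) : ℝ)) * ((M2q n (m' + 1) c X + 1 : ℕ) : ℝ) + 1 := by positivity
  have hlMM : Real.log ((((m' + 1 : ℕ) : ℝ)) * ((M2q n (m' + 1) c X + 1 : ℕ) : ℝ) + 1) ≤ Real.log c₄ + Real.log X := by
    rw [← Real.log_mul (by positivity) hXpos.ne']; exact Real.log_le_log hMM0 hMM
  have hlc₄ : 0 ≤ Real.log c₄ := Real.log_nonneg hc₄1
  have hDP : (Dq n (m' + 1) X : ℝ) ≤ aD n (m' + 1) * P := by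
    rw [hD]; exact mul_le_mul_of_nonneg_left hSle (by positivity)
  have b4 : (Dq n (m' + 1) X : ℝ) * Real.log ((((m' + 1 : ℕ) : ℝ)) * ((M2q n (m' + 1) c X + 1 : ℕ) : ℝ) + 1) ≤
      aD n (m' + 1) * (Real.log c₄ + 1) * Φ := by
    calc _ ≤ (aD n (m' + 1) * P) * (Real.log c₄ + Real.log X) :=
          mul_le_mul hDP hlMM (Real.log_nonneg (by linarith [(by positivity : (0:ℝ) ≤ (((m' + 1 : ℕ) : ℝ)) * ((M2q n (m' + 1) c X + 1 : ℕ) : ℝ))])) (by positivity)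
      _ = aD n (m' + 1) * (P * Real.log c₄ + Φ) := by rw [← hPl]; ring
      _ ≤ aD n (m' + 1) * (Φ * Real.log c₄ + Φ) := by gcongr
      _ = _ := by ring
  -- (5) `Tdeg ≤ K_T P`
  have hKT1 : 1 ≤ KT n m' c := by
    rw [KT]; have : (0 : ℝ) ≤ cb n (m' + 1) * Fintype.card (Var n (m' + 1)) := by positivity
    have : (0 : ℝ) ≤ n * ((m' + 1 : ℕ) : ℝ) * (((n : ℝ) + 1) * aB n (m' + 1) c + 1) := by positivity
    linarith
  have hT : (Tdeg n m' c X : ℝ) ≤ KT n m' c * P := by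
    unfold Tdeg; rw [← hV]; push_cast
    have t1 : (((bq n (m' + 1) X - 1 : ℕ) : ℝ)) * V ≤ cb n (m' + 1) * V * P := by
      have : (((bq n (m' + 1) X - 1 : ℕ) : ℝ)) ≤ cb n (m' + 1) * P := by
        calc (((bq n (m' + 1) X - 1 : ℕ) : ℝ)) ≤ bq n (m' + 1) X := by exact_mod_cast Nat.sub_le _ _
          _ = cb n (m' + 1) * Sq n (m' + 1) X := hb
          _ ≤ cb n (m' + 1) * P := mul_le_mul_of_nonneg_left hSle (by linarith)
      calc (((bq n (m' + 1) X - 1 : ℕ) : ℝ)) * V ≤ (cb n (m' + 1) * P) * V := mul_le_mul_of_nonneg_right this (Nat.cast_nonneg _)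
        _ = _ := by ring
    have t3 : (Dq n (m' + 1) X : ℝ) ≤ aD n (m' + 1) * P := hDP
    have t4 : (n : ℝ) * (((m' + 1 : ℕ) : ℝ)) * Lq n (m' + 1) X * ((M2q n (m' + 1) c X : ℝ) + 1) ≤
        n * ((m' + 1 : ℕ) : ℝ) * (((n : ℝ) + 1) * aB n (m' + 1) c + 1) * P := by
      have hLM : (Lq n (m' + 1) X : ℝ) * ((M2q n (m' + 1) c X : ℝ) + 1) ≤ (((n : ℝ) + 1) * aB n (m' + 1) c + 1) * P := by
        rw [hM2q]
        have hs0 : 0 ≤ scale ((((m' + 1 : ℕ) : ℝ)) / n) 0 X := scale_nonneg hX1.le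
        have hM1 : ((n : ℝ) + 1) * aB n (m' + 1) c * Mq X + 1 ≤ (((n : ℝ) + 1) * aB n (m' + 1) c + 1) * X := by
          have h1 : ((n : ℝ) + 1) * aB n (m' + 1) c * Mq X ≤ ((n : ℝ) + 1) * aB n (m' + 1) c * X := by gcongr
          nlinarith
        calc (Lq n (m' + 1) X : ℝ) * (((n : ℝ) + 1) * aB n (m' + 1) c * Mq X + 1)
            ≤ scale ((((m' + 1 : ℕ) : ℝ)) / n) 0 X * ((((n : ℝ) + 1) * aB n (m' + 1) c + 1) * X) :=
              mul_le_mul hLle hM1 (by positivity) hs0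
          _ = (((n : ℝ) + 1) * aB n (m' + 1) c + 1) * (scale ((((m' + 1 : ℕ) : ℝ)) / n) 0 X * X) := by ring
          _ = _ := by rw [hsP]
      calc (n : ℝ) * (((m' + 1 : ℕ) : ℝ)) * Lq n (m' + 1) X * ((M2q n (m' + 1) c X : ℝ) + 1)
          = (n : ℝ) * (((m' + 1 : ℕ) : ℝ)) * ((Lq n (m' + 1) X : ℝ) * ((M2q n (m' + 1) c X : ℝ) + 1)) := by ring
        _ ≤ (n : ℝ) * (((m' + 1 : ℕ) : ℝ)) * ((((n : ℝ) + 1) * aB n (m' + 1) c + 1) * P) :=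
            mul_le_mul_of_nonneg_left hLM (by positivity)
        _ = _ := by ring
    rw [KT]
    have t2 : (Sq n (m' + 1) X : ℝ) ≤ 1 * P := by rw [one_mul]; exact hSle
    have hKTexp : (cb n (m' + 1) * (V : ℝ) + 1 + aD n (m' + 1) +
        n * ((m' + 1 : ℕ) : ℝ) * (((n : ℝ) + 1) * aB n (m' + 1) c + 1)) * P =
        cb n (m' + 1) * V * P + 1 * P + aD n (m' + 1) * P +
          n * ((m' + 1 : ℕ) : ℝ) * (((n : ℝ) + 1) * aB n (m' + 1) c + 1) * P := by ring
    rw [hKTexp]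
    push_cast at t1 t2 t3 t4 ⊢
    linarith [t1, t2, t3, t4]
  have hT0 : 0 < (Tdeg n m' c X : ℝ) := by
    have : 1 ≤ Tdeg n m' c X := by unfold Tdeg; omega
    exact_mod_cast this
  have hlT : Real.log (Tdeg n m' c X) ≤ (Real.log (KT n m' c) + 1 + (((m' + 1 : ℕ) : ℝ)) / n) * Φ := by
    have hlKT : 0 ≤ Real.log (KT n m' c) := Real.log_nonneg hKT1
    calc Real.log (Tdeg n m' c X) ≤ Real.log (KT n m' c * P) := Real.log_le_log hT0 hT
      _ = Real.log (KT n m' c) + (1 + (((m' + 1 : ℕ) : ℝ)) / n) * Real.log X := by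
          rw [Real.log_mul (by positivity) hP0.ne', hlogP]
      _ ≤ Real.log (KT n m' c) * Φ + (1 + (((m' + 1 : ℕ) : ℝ)) / n) * Φ := by
          gcongr
          · calc Real.log (KT n m' c) = Real.log (KT n m' c) * 1 := (mul_one _).symm
              _ ≤ _ := mul_le_mul_of_nonneg_left hΦ1 hlKT
      _ = _ := by ring
  have b5 : (Tdeg n m' c X : ℝ) * Real.log A ≤ KT n m' c * Real.log A * Φ := by
    have hlA : 0 ≤ Real.log A := Real.log_nonneg hA
    calc (Tdeg n m' c X : ℝ) * Real.log A ≤ (KT n m' c * P) * Real.log A := mul_le_mul_of_nonneg_right hT hlA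
      _ ≤ (KT n m' c * Φ) * Real.log A := by gcongr
      _ = _ := by ring
  -- exponential forms of the six factors
  have xAM : (Fintype.card (AM n (Dq n (m' + 1) X) (Lq n (m' + 1) X)) : ℝ) ≤ Real.exp (KAM n (m' + 1) * Φ) := by
    rw [← Real.exp_log hAM0]; exact Real.exp_le_exp.mpr b1
  have xC : (2 : ℝ) ^ ((bq n (m' + 1) X - 1) * V) *
      (Fintype.card (ExpIdx n (m' + 1) (bq n (m' + 1) X)) * Hgt3 n (m' + 1) X) ≤ Real.exp (KC n (m' + 1) A * Φ) := by
    rw [← Real.exp_log hpart0]; exact Real.exp_le_exp.mpr b2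
  have xDL : (((Dq n (m' + 1) X : ℝ)) + n * Lq n (m' + 1) X) ^ Sq n (m' + 1) X ≤
      Real.exp ((Real.log (aD n (m' + 1) + n) + 1 + (((m' + 1 : ℕ) : ℝ)) / n) * Φ) := by
    have h0 : 0 < (((Dq n (m' + 1) X : ℝ)) + n * Lq n (m' + 1) X) ^ Sq n (m' + 1) X := by positivity
    rw [← Real.exp_log h0, Real.log_pow]; exact Real.exp_le_exp.mpr b3
  have xM : ((((m' + 1 : ℕ) : ℝ)) * ((M2q n (m' + 1) c X + 1 : ℕ) : ℝ) + 1) ^ Dq n (m' + 1) X ≤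
      Real.exp (aD n (m' + 1) * (Real.log c₄ + 1) * Φ) := by
    have h0 : 0 < ((((m' + 1 : ℕ) : ℝ)) * ((M2q n (m' + 1) c X + 1 : ℕ) : ℝ) + 1) ^ Dq n (m' + 1) X := by positivity
    rw [← Real.exp_log h0, Real.log_pow]; exact Real.exp_le_exp.mpr b4
  have xT : (Tdeg n m' c X : ℝ) ≤ Real.exp ((Real.log (KT n m' c) + 1 + (((m' + 1 : ℕ) : ℝ)) / n) * Φ) := by
    rw [← Real.exp_log hT0]; exact Real.exp_le_exp.mpr hlT
  have xA : A ^ Tdeg n m' c X ≤ Real.exp (KT n m' c * Real.log A * Φ) := by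
    have h0 : 0 < A ^ Tdeg n m' c X := by positivity
    rw [← Real.exp_log h0, Real.log_pow]; exact Real.exp_le_exp.mpr b5
  -- assemble
  have hTC : -rho3 n (m' + 1) X + TC n m' c A * Φ =
      KAM n (m' + 1) * Φ + KC n (m' + 1) A * Φ + (Real.log (aD n (m' + 1) + n) + 1 + (((m' + 1 : ℕ) : ℝ)) / n) * Φ +
        aD n (m' + 1) * (Real.log c₄ + 1) * Φ + (Real.log (KT n m' c) + 1 + (((m' + 1 : ℕ) : ℝ)) / n) * Φ +
        KT n m' c * Real.log A * Φ + -rho3 n (m' + 1) X := by rw [TC, ← hc₄]; ring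
  rw [hTC, Real.exp_add, Real.exp_add, Real.exp_add, Real.exp_add, Real.exp_add, Real.exp_add]
  unfold termC; rw [← hV]
  have e0 := Real.exp_pos (KAM n (m' + 1) * Φ)
  calc _ = (Fintype.card (AM n (Dq n (m' + 1) X) (Lq n (m' + 1) X)) : ℝ) *
        ((2 : ℝ) ^ ((bq n (m' + 1) X - 1) * V) * (Fintype.card (ExpIdx n (m' + 1) (bq n (m' + 1) X)) * Hgt3 n (m' + 1) X)) *
        (((Dq n (m' + 1) X : ℝ)) + n * Lq n (m' + 1) X) ^ Sq n (m' + 1) X *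
        ((((m' + 1 : ℕ) : ℝ)) * ((M2q n (m' + 1) c X + 1 : ℕ) : ℝ) + 1) ^ Dq n (m' + 1) X *
        (Tdeg n m' c X : ℝ) * A ^ Tdeg n m' c X * Real.exp (-rho3 n (m' + 1) X) := by ring
    _ ≤ Real.exp (KAM n (m' + 1) * Φ) * Real.exp (KC n (m' + 1) A * Φ) *
        Real.exp ((Real.log (aD n (m' + 1) + n) + 1 + (((m' + 1 : ℕ) : ℝ)) / n) * Φ) *
        Real.exp (aD n (m' + 1) * (Real.log c₄ + 1) * Φ) *
        Real.exp ((Real.log (KT n m' c) + 1 + (((m' + 1 : ℕ) : ℝ)) / n) * Φ) *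
        Real.exp (KT n m' c * Real.log A * Φ) * Real.exp (-rho3 n (m' + 1) X) := by
        have hA0 : 0 ≤ A := by linarith
        refine mul_le_mul ?_ le_rfl (Real.exp_pos _).le (by positivity)
        refine mul_le_mul ?_ xA (pow_nonneg hA0 _) (by positivity)
        refine mul_le_mul ?_ xT hT0.le (by positivity)
        refine mul_le_mul ?_ xM (by positivity) (by positivity)
        refine mul_le_mul ?_ xDL (by positivity) (by positivity)
        exact mul_le_mul xAM xC hpart0.le e0.le

end LogBounds


/-! ### The smallness conditions on `ε_b = e^{-ρ}` and the final eventual statement -/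

section Final

variable {m' : ℕ}

/-- The constant `K_E` of the conditions on `ε_b`: they hold as soon as `K_E ≤ X`. [folklore] -/
def KE (n m' : ℕ) (A Cx : ℝ) (x : Fin (m' + 1) → ℂ) : ℝ :=
  Real.log (2 * A + 1) + (Real.log (2 * (((m' + 1 : ℕ) : ℝ))) + 1 + Cx) + Real.log (((m' + 1 : ℕ) : ℝ)) +
    Real.log n + |Real.log (2 / ‖x (Fin.last m')‖)|

/-- **The six conditions on `ε_b = e^{-ρ}` at a good `X ≥ K_E` with `K_κ Φ ≤ Ψ`.** [folklore] -/
theorem eps_conditions (hn : 1 ≤ n) {c : ℕ} {X : ℝ} (h : GoodSize n (m' + 1) c X) (y : Fin n → ℂ)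
    (x : Fin (m' + 1) → ℂ) (hxlast : x (Fin.last m') ≠ 0) {Cx : ℝ} (hCx : 0 ≤ Cx)
    (hKE : KE n m' (Abd y x) Cx x ≤ X) (hKK : KK n (m' + 1) c (Abd y x) * Phi3 n (m' + 1) X ≤ Psi3 n (m' + 1) X) :
    (2 * Abd y x + 1) * Real.exp (-rho3 n (m' + 1) X) ≤ 1 ∧
    (n : ℝ) * (m' + 1) * Lq n (m' + 1) X * M2q n (m' + 1) c X *
      (cbeta (Abd y x) * Real.exp (-rho3 n (m' + 1) X)) ≤ 1 ∧
    ((m' : ℝ) + 1) * Mq X * Real.exp (-rho3 n (m' + 1) X) ≤ Real.exp (-(Cx * Mq X)) / 2 ∧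
    ((m' : ℝ) + 1) * Real.exp (-rho3 n (m' + 1) X) ≤ 1 ∧
    (n : ℝ) * Real.exp (-rho3 n (m' + 1) X) ≤ 1 ∧
    Real.exp (-rho3 n (m' + 1) X) ≤ ‖x (Fin.last m')‖ / 2 := by
  have hm : 1 ≤ m' + 1 := Nat.succ_pos m'
  obtain ⟨hX1, hlog, hP1, hXP, -, -, -, -, hPX, hPO, -, hOΨ, -⟩ := atoms hn hm h.hX
  obtain ⟨-, -, hS4, -, -, hMle, hM2, -⟩ := sizes hn hm h
  set A : ℝ := Abd y x with hAdef
  set Ψ : ℝ := Psi3 n (m' + 1) X with hΨ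
  have hA2 : 2 ≤ A := by
    rw [hAdef, Abd]; have : 0 ≤ ∑ v, ‖pt y x v‖ := Finset.sum_nonneg fun _ _ => norm_nonneg _; linarith
  have hXpos : 0 < X := by linarith
  have hρ : rho3 n (m' + 1) X = 4 * Ψ := by rw [hΨ]; rfl
  -- `X ≤ Ψ` and `X² ≤ Ψ`
  have hP0 : 0 ≤ Pw n (m' + 1) X := by linarith
  have hXΨ : X ≤ Ψ := by
    have : Pw n (m' + 1) X ≤ Pw n (m' + 1) X * X := by
      calc Pw n (m' + 1) X = Pw n (m' + 1) X * 1 := (mul_one _).symm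
        _ ≤ Pw n (m' + 1) X * X := mul_le_mul_of_nonneg_left hX1.le hP0
    linarith
  have hX2Ψ : X * X ≤ Ψ := by
    have : X * X ≤ Pw n (m' + 1) X * X := mul_le_mul_of_nonneg_right hXP hXpos.le
    linarith
  have hΨ0 : 0 ≤ Ψ := by linarith
  -- the pieces of `K_E`
  have hn1 : (1 : ℝ) ≤ n := by exact_mod_cast hn
  have hm1 : (1 : ℝ) ≤ ((m' + 1 : ℕ) : ℝ) := by exact_mod_cast hm
  have hxl : 0 < ‖x (Fin.last m')‖ := norm_pos_iff.mpr hxlast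
  have k1 : 0 ≤ Real.log (2 * A + 1) := Real.log_nonneg (by linarith)
  have k2 : 0 ≤ Real.log (2 * (((m' + 1 : ℕ) : ℝ))) := Real.log_nonneg (by linarith)
  have k3 : 0 ≤ Real.log (((m' + 1 : ℕ) : ℝ)) := Real.log_nonneg hm1
  have k4 : 0 ≤ Real.log n := Real.log_nonneg hn1
  have k5 : Real.log (2 / ‖x (Fin.last m')‖) ≤ |Real.log (2 / ‖x (Fin.last m')‖)| := le_abs_self _
  have k5' : 0 ≤ |Real.log (2 / ‖x (Fin.last m')‖)| := abs_nonneg _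
  have hKEdef : KE n m' A Cx x = Real.log (2 * A + 1) + (Real.log (2 * (((m' + 1 : ℕ) : ℝ))) + 1 + Cx) +
      Real.log (((m' + 1 : ℕ) : ℝ)) + Real.log n + |Real.log (2 / ‖x (Fin.last m')‖)| := rfl
  rw [hKEdef] at hKE
  have hεb : Real.exp (-rho3 n (m' + 1) X) = Real.exp (-(4 * Ψ)) := by rw [hρ]
  rw [hεb]
  refine ⟨?_, ?_, ?_, ?_, ?_, ?_⟩
  · -- (E1)
    have h1 : Real.exp (-(4 * Ψ)) ≤ (2 * A + 1)⁻¹ := by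
      calc Real.exp (-(4 * Ψ)) ≤ Real.exp (-Real.log (2 * A + 1)) := Real.exp_le_exp.mpr (by linarith)
        _ = (2 * A + 1)⁻¹ := by rw [Real.exp_neg, Real.exp_log (by linarith)]
    calc (2 * A + 1) * Real.exp (-(4 * Ψ)) ≤ (2 * A + 1) * (2 * A + 1)⁻¹ :=
          mul_le_mul_of_nonneg_left h1 (by linarith)
      _ = 1 := mul_inv_cancel₀ (by linarith)
  · -- (E2): the left-hand side is `κ/3`
    have hA1 : 1 ≤ A := by linarith
    have hκ := log_kapX_le hn h hA1
    have hκ0 := kapX_pos hn h hA1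
    have hle : Real.log (kapX n m' c A X) ≤ 0 := by rw [hρ] at hκ; linarith
    have hκ1 : kapX n m' c A X ≤ 1 := by
      have := Real.exp_le_exp.mpr hle; rwa [Real.exp_log hκ0, Real.exp_zero] at this
    have hid : (n : ℝ) * (m' + 1) * Lq n (m' + 1) X * M2q n (m' + 1) c X * (cbeta A * Real.exp (-(4 * Ψ))) =
        kapX n m' c A X / 3 := by rw [kapX, hρ]; ring
    rw [hid]; linarith
  · -- (E3)
    have hM0 : (0 : ℝ) < Mq X := by linarith
    have hlogM : Real.log (Mq X) ≤ X :=
      (Real.log_le_log hM0 hMle).trans ((Real.log_le_sub_one_of_pos hXpos).trans (by linarith))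
    have key : Real.log (2 * (((m' : ℝ) + 1) * Mq X)) + Cx * Mq X ≤ 4 * Ψ := by
      rw [Real.log_mul (by norm_num) (by positivity), Real.log_mul (by positivity) hM0.ne']
      have hCM : Cx * Mq X ≤ Cx * X := mul_le_mul_of_nonneg_left hMle hCx
      have h2m : Real.log 2 + Real.log ((m' : ℝ) + 1) = Real.log (2 * (((m' + 1 : ℕ) : ℝ))) := by
        rw [Real.log_mul (by norm_num) (by positivity)]; push_cast; ring
      have hb : (Real.log (2 * (((m' + 1 : ℕ) : ℝ))) + 1 + Cx) * X ≤ 4 * (X * X) := by nlinarith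
      nlinarith
    have h1 : 2 * (((m' : ℝ) + 1) * Mq X) * Real.exp (-(4 * Ψ)) ≤ Real.exp (-(Cx * Mq X)) := by
      have hpos : 0 < 2 * (((m' : ℝ) + 1) * Mq X) := mul_pos (by norm_num) (mul_pos (by positivity) hM0)
      calc 2 * (((m' : ℝ) + 1) * Mq X) * Real.exp (-(4 * Ψ))
          = Real.exp (Real.log (2 * (((m' : ℝ) + 1) * Mq X)) - 4 * Ψ) := by
            rw [Real.exp_sub, Real.exp_log hpos]; simp [Real.exp_neg, div_eq_mul_inv]
        _ ≤ Real.exp (-(Cx * Mq X)) := Real.exp_le_exp.mpr (by linarith)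
    linarith
  · -- (E4)
    have h1 : Real.exp (-(4 * Ψ)) ≤ ((m' : ℝ) + 1)⁻¹ := by
      calc Real.exp (-(4 * Ψ)) ≤ Real.exp (-Real.log (((m' + 1 : ℕ) : ℝ))) := Real.exp_le_exp.mpr (by linarith)
        _ = ((m' : ℝ) + 1)⁻¹ := by rw [Real.exp_neg, Real.exp_log (by positivity)]; push_cast; ring
    calc ((m' : ℝ) + 1) * Real.exp (-(4 * Ψ)) ≤ ((m' : ℝ) + 1) * ((m' : ℝ) + 1)⁻¹ :=
          mul_le_mul_of_nonneg_left h1 (by positivity)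
      _ = 1 := mul_inv_cancel₀ (by positivity)
  · -- (E5)
    have h1 : Real.exp (-(4 * Ψ)) ≤ (n : ℝ)⁻¹ := by
      calc Real.exp (-(4 * Ψ)) ≤ Real.exp (-Real.log n) := Real.exp_le_exp.mpr (by linarith)
        _ = (n : ℝ)⁻¹ := by rw [Real.exp_neg, Real.exp_log (by positivity)]
    calc (n : ℝ) * Real.exp (-(4 * Ψ)) ≤ (n : ℝ) * (n : ℝ)⁻¹ := mul_le_mul_of_nonneg_left h1 (by positivity)
      _ = 1 := mul_inv_cancel₀ (by positivity)
  · -- (E6)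
    calc Real.exp (-(4 * Ψ)) ≤ Real.exp (-Real.log (2 / ‖x (Fin.last m')‖)) :=
          Real.exp_le_exp.mpr (by linarith)
      _ = ‖x (Fin.last m')‖ / 2 := by rw [Real.exp_neg, Real.exp_log (by positivity), inv_div]

/-- Separation of the points `l·x`, `l ∈ [0,M)^m`, from a linear measure of independence of `x`.
[folklore] -/
theorem separated_of_measure1 (x : Fin (m' + 1) → ℂ) {Cx : ℝ}
    (hx : ∀ h : Fin (m' + 1) → ℤ, h ≠ 0 → ∀ H : ℝ, (∀ i, (|h i| : ℝ) ≤ H) →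
      Real.exp (-(Cx * H ^ (1 : ℝ))) ≤ ‖∑ i, (h i : ℂ) * x i‖) (M : ℕ) :
    Separated x M (Real.exp (-(Cx * M))) := by
  intro ν hν hνM
  have h := hx ν hν M (fun k => by exact_mod_cast (hνM k).le)
  rwa [Real.rpow_one] at h

set_option maxHeartbeats 800000 in
/-- **The family is small at `θ`, eventually.** For `n ≥ 1` frequencies `y`, `m = m'+1` points `x`
with `x_m ≠ 0` and a linear measure of independence (constant `C_x ≥ 0`), and the constant `c` of
the zero lemma: for all large `X`, for Siegel's unknowns `p` (`|p| ≤ H`, `Q_{l,t} = 0` on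
`[0,M)^m × [0,S)`), every `θ'` in the ball `max|θ'_v - θ_v| ≤ e^{-ρ}`, every minimal index `j` at
`θ'`, every `l ≤ M₂` and `t < S`: `|Q_{l,t,j}(θ)| ≤ e^{-Ψ/2^{m+4}}`.
[cite: Diaz1989, §II-4-2 p. 15 (the model, without multiplicities)] -/
theorem eventually_small3 (hn : 1 ≤ n) (y : Fin n → ℂ) (x : Fin (m' + 1) → ℂ)
    (hxlast : x (Fin.last m') ≠ 0) {Cx : ℝ} (hCx : 0 ≤ Cx)
    (hx : ∀ h : Fin (m' + 1) → ℤ, h ≠ 0 → ∀ H : ℝ, (∀ i, (|h i| : ℝ) ≤ H) →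
      Real.exp (-(Cx * H ^ (1 : ℝ))) ≤ ‖∑ i, (h i : ℂ) * x i‖) (c : ℕ) :
    ∀ᶠ X in atTop, ∀ (p : Unk n (m' + 1) (Dq n (m' + 1) X) (Lq n (m' + 1) X) (bq n (m' + 1) X) → ℤ),
      (∀ w, |(p w : ℝ)| ≤ Hgt3 n (m' + 1) X) →
      (∀ l : Fin (m' + 1) → ℕ, (∀ k, l k < Mq X) → ∀ t < Sq n (m' + 1) X, Q p l t = 0) →
      ∀ θ' : Var n (m' + 1) → ℂ, (∀ v, ‖θ' v - pt y x v‖ ≤ Real.exp (-rho3 n (m' + 1) X)) →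
      ∀ j : Var n (m' + 1) →₀ ℕ, IsMinIdx p θ' j →
      ∀ l : Fin (m' + 1) → ℕ, (∀ k, l k ≤ M2q n (m' + 1) c X) → ∀ t < Sq n (m' + 1) X,
        ‖aeval (pt y x) (Qj p l t j)‖ ≤ Real.exp (-(Psi3 n (m' + 1) X / 2 ^ (m' + 5))) := by
  have hm : 1 ≤ m' + 1 := Nat.succ_pos m'
  set A : ℝ := Abd y x with hAdef
  set X0 : ℝ := X0s x with hX0def
  set Y0 : ℝ := Y0s y with hY0def
  set K : ℝ := KR n m' c x with hKdef
  have hK4 : 4 ≤ K := four_le_KR (n := n) c x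
  have hω : 0 < omega0 x := by
    unfold omega0; exact lt_min one_pos (by have := norm_pos_iff.mpr hxlast; positivity)
  have ha : (1 : ℝ) + (((m' + 1 : ℕ) : ℝ)) / n < 1 + (((m' + 1 : ℕ) : ℝ)) / n + ((m' + 1 : ℕ) : ℝ) := by
    have : (0 : ℝ) < ((m' + 1 : ℕ) : ℝ) := by positivity
    linarith
  have hapos : (0 : ℝ) < 1 + (((m' + 1 : ℕ) : ℝ)) / n + ((m' + 1 : ℕ) : ℝ) := by positivity
  -- the eventual numerical facts
  have ev1 := eventually_goodSize (n := n) hn hm c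
  have ev2 : ∀ᶠ X : ℝ in atTop, 2 * ((X0 + 1) * X) ≤ K * X ^ 2 := by
    filter_upwards [eventually_ge_atTop (2 * (X0 + 1) / K), eventually_ge_atTop (0 : ℝ)] with X hX hX0
    have hK0 : 0 < K := by linarith
    have : 2 * (X0 + 1) ≤ K * X := by rw [div_le_iff₀ hK0] at hX; linarith
    nlinarith
  have ev3 := eventually_ge_atTop (KE n m' A Cx x)
  have ev4 := eventually_mul_scale_le_of_lt ha 1 1 (KK n (m' + 1) c A)
  have ev5 := eventually_mul_scale_le_of_lt ha 1 1 (TA n m' c A X0 Y0 Cx (omega0 x) K * 2 ^ (m' + 5))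
  have ev6 := eventually_mul_scale_le_of_lt_right (1 + (((m' + 1 : ℕ) : ℝ)) / n + ((m' + 1 : ℕ) : ℝ))
    (by norm_num : (0 : ℝ) < 1) (TA n m' c A X0 Y0 Cx (omega0 x) K * 2 ^ (m' + 5))
  have ev7 := eventually_const_le_scale (a := 1 + (((m' + 1 : ℕ) : ℝ)) / n + ((m' + 1 : ℕ) : ℝ)) (b := 1)
    (Or.inl hapos) (Real.log 9 * 2 ^ (m' + 5))
  have ev8 := eventually_mul_scale_le_of_lt ha 1 1 (TB n m' c A X0 Y0)
  have ev9 := eventually_mul_scale_le_of_lt ha 1 1 (TC n m' c A)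
  have ev10 := eventually_const_le_scale (a := 1 + (((m' + 1 : ℕ) : ℝ)) / n + ((m' + 1 : ℕ) : ℝ)) (b := 1)
    (Or.inl hapos) (Real.log 3)
  filter_upwards [ev1, ev2, ev3, ev4, ev5, ev6, ev7, ev8, ev9, ev10] with X hG hq hKE hKK h5 h6 h7 h8 h9 h10
    p hHb hQ θ' hball j hj l hl t ht
  -- unfold the scales
  have hΦ : scale (1 + (((m' + 1 : ℕ) : ℝ)) / n) 1 X = Phi3 n (m' + 1) X := rfl
  have hΨ : scale (1 + (((m' + 1 : ℕ) : ℝ)) / n + ((m' + 1 : ℕ) : ℝ)) 1 X = Psi3 n (m' + 1) X := rfl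
  have hΩ : scale (1 + (((m' + 1 : ℕ) : ℝ)) / n + ((m' + 1 : ℕ) : ℝ)) 0 X = Om n (m' + 1) X := rfl
  rw [hΦ, hΨ] at hKK h5 h8 h9
  rw [hΩ, hΨ] at h6
  rw [hΨ] at h7 h10
  obtain ⟨hX1, -, hP1, -, -, -, -, hPΦ, -, hPO, hΦΨ, hOΨ, -⟩ := atoms hn hm hG.hX
  have hΨ0 : 0 ≤ Psi3 n (m' + 1) X := by linarith
  have h2pos : (0 : ℝ) < 2 ^ (m' + 5) := by positivity
  -- the three terms
  have hA' := termA_le hn hG hCx y x hω hq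
  have hB' := termB_le hn hG y x
  have hC' := termC_le hn hG (A := A) (by
    rw [hAdef, Abd]; have : 0 ≤ ∑ v, ‖pt y x v‖ := Finset.sum_nonneg fun _ _ => norm_nonneg _; linarith)
  rw [← hAdef, ← hX0def, ← hY0def, ← hKdef] at hA'
  rw [← hAdef, ← hX0def, ← hY0def] at hB'
  have e3 : Real.exp (-(Psi3 n (m' + 1) X / 2 ^ (m' + 5))) / 3 =
      Real.exp (-(Psi3 n (m' + 1) X / 2 ^ (m' + 5)) - Real.log 3) := by
    rw [Real.exp_sub, Real.exp_log (by norm_num)]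
  have hl39 : Real.log 3 + Real.log 3 = Real.log 9 := by
    rw [← Real.log_mul (by norm_num) (by norm_num)]; norm_num
  have i1 : TA n m' c A X0 Y0 Cx (omega0 x) K * Phi3 n (m' + 1) X ≤ Psi3 n (m' + 1) X / 2 ^ (m' + 5) := by
    rw [le_div_iff₀ h2pos]; linarith
  have i2 : TA n m' c A X0 Y0 Cx (omega0 x) K * Om n (m' + 1) X ≤ Psi3 n (m' + 1) X / 2 ^ (m' + 5) := by
    rw [le_div_iff₀ h2pos]; linarith
  have i3 : Real.log 9 ≤ Psi3 n (m' + 1) X / 2 ^ (m' + 5) := by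
    rw [le_div_iff₀ h2pos]; linarith
  have i4 : Psi3 n (m' + 1) X / 2 ^ (m' + 3) = 4 * (Psi3 n (m' + 1) X / 2 ^ (m' + 5)) := by
    rw [pow_add, pow_add]; field_simp; ring
  have i5 : Psi3 n (m' + 1) X / 2 ^ (m' + 5) ≤ Psi3 n (m' + 1) X := by
    rw [div_le_iff₀ h2pos]
    calc Psi3 n (m' + 1) X = Psi3 n (m' + 1) X * 1 := (mul_one _).symm
      _ ≤ Psi3 n (m' + 1) X * 2 ^ (m' + 5) := mul_le_mul_of_nonneg_left (one_le_pow₀ (by norm_num)) hΨ0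
  have hρ : rho3 n (m' + 1) X = 4 * Psi3 n (m' + 1) X := rfl
  have hTA : termA n m' c y x A Cx X ≤ Real.exp (-(Psi3 n (m' + 1) X / 2 ^ (m' + 5))) / 3 := by
    refine hA'.trans ?_
    rw [e3, i4]
    have eq1 : ∀ u : ℝ, 3 * Real.exp u = Real.exp (u + Real.log 3) := fun u => by
      rw [Real.exp_add, Real.exp_log (by norm_num)]; ring
    rw [eq1]
    exact Real.exp_le_exp.mpr (by linarith)
  have hTB : termB n m' c y x A X ≤ Real.exp (-(Psi3 n (m' + 1) X / 2 ^ (m' + 5))) / 3 := by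
    refine hB'.trans ?_
    rw [e3, hρ]
    exact Real.exp_le_exp.mpr (by linarith)
  have hTC : termC n m' c A X ≤ Real.exp (-(Psi3 n (m' + 1) X / 2 ^ (m' + 5))) / 3 := by
    refine hC'.trans ?_
    rw [e3, hρ]
    exact Real.exp_le_exp.mpr (by linarith)
  -- the six conditions and the conclusion
  obtain ⟨hε1, hε2, hε3, hε4, hε5, hε6⟩ := eps_conditions hn hG y x hxlast hCx hKE hKK
  exact small_of_bounds y x hxlast hCx c hX1.le (separated_of_measure1 x hx (Mq X)) hG.M2 hG.H1
    hε1 hε2 hε3 hε4 hε5 hε6 hTA hTB hTC p hHb hQ hball hj hl ht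

end Final

end DiazMainIII

end Literature.NumberTheory.Transcendental

end
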